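import Mathlib.Tactic.DeriveFintype
import Mathlib.Data.Prod.Lex
import Mathlib.Data.Fintype.Prod
import Literature.Computability.AlgebraicComplexity.HamiltonianCycleSumLemmas
import HarnessLib

/-!
# The Boolean band: a Hamiltonian-cycle gadget absorbing a permanent with a Boolean sum

This file CONSTRUCTS, for a square matrix `A` over `k ∪ {X_i} ∪ {Y_1, …, Y_t}` (entries
`k ⊕ (σ ⊕ Fin t)`, as in `PermanentCompleteness.lean`), an explicit square matrix `bandM A`
over `k ∪ {X_i}` (entries `k ⊕ σ`, constants `0, 1, 2` and the non-Boolean entries of `A`) on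
the vertex type `HCBand.Node N t` of size `5N² + N + t + 1`, whose Hamiltonian cycle sum is the
Boolean sum of the permanents of `A`,

  `HC(bandM A) = ∑_{e ∈ {0,1}^t} per A(X, e)`        (`entryHC_bandM`, `HCBoolBandSum.lean`),

provided every ROW of `A` contains at most one Boolean variable (`HCBand.RowProp`). This is the
third step of the `VNP`-completeness of the Hamiltonian cycle family over EVERY field
(Valiant 1979; von zur Gathen 1987, Thm. 5.6; Bürgisser–Clausen–Shokrollahi 1997,
Thm. (21.17)(1), whose proof BCS do not print): composed with `VNP = VNP_e` (BCS Thm. (21.26))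
and the universality of the permanent for formulas with the column property (BCS Thm. (21.27),
transposed), it shows that every p-definable family is a p-projection of `HC`
(`ValiantHCCompleteness.lean`).

## The construction (architecture of von zur Gathen 1987, §5; gadgets re-derived)

von zur Gathen proves Thm. 5.6 by simulating *coupled permanents* (which absorb the Boolean
sum, Lemma 5.1) by Hamiltonian cycles on a "Möbus band" of beads, one bead per matrix
position, with shared row and column nodes, and then removing the couples by a second gadget
hung on a special edge ((10.1)–(11.3)); the gadget figures (Figs. 8–21) are not reproduced in
our copy of the source. We use the same architecture — one bead per position `(a, b)`, threaded
column block by column block, a shared hub `r_a` per row recording that row `a` is covered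
exactly once — with gadgets re-derived and validated by exhaustive computer search (all
`N ≤ 3` and random `N = 4` instances), chosen so that every correctness argument is LOCAL:

* bead `(a,b)`: nodes `p0, p1, p2, p3` and a private node `z = zed a b`; arcs
  `p0→p2, p2→p1, p1→p3, p3→p2, p2→p0, p0→z, z→p3, p1→z`; it is traversed in exactly one of the
  patterns `L0 = p0 p2 p1 (z) p3 → next p0` (lane 0: the block's row is still to come),
  `U = p0 z p3 p2 p1 → r_a` (the block USES row `a`, weight `A a b` on the arc `p1 → r_a`),
  `L1 = p1 (z) p3 p2 p0 → next p1` (lane 1), the detour through `z` being optional on the two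
  bypass lanes and compulsory on `U`; the bead admits NO traversal by two strands, which makes
  all "starvation" arguments local;
* hub `r_a`: entered by the `U`-bead of row `a`, returns to lane 1 of the next bead of the
  same block (`n1T`), so each row is used exactly once and leaks are impossible;
* Boolean variable `Y_j` with occurrences `q_1 < ⋯ < q_m` (lexicographic): a switch node `s_j`
  with the direct arc `s_j → s_{j+1}` ("`Y_j = 1`": every `z_{q_i}` is absorbed by its bead,
  which is then free) and the chain `s_j → z_{q_1} → ⋯ → z_{q_m} → s_{j+1}` ("`Y_j = 0`": the
  chain consumes the `z`'s, so no occurrence bead can be used); a cover avoiding all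
  occurrences is thus counted twice and a cover using one once, which is
  `∑_{e_j} e_j^{#used occurrences}`; a variable without occurrences gets weight `2` on its
  direct arc; `s_t` closes the thread into the first bead.

The row property is essential (two occurrences of one variable in one row admit a spurious
Hamiltonian cycle); it is supplied by transposing the column property (D) of BCS Thm. (21.27).

## Contents of this file

* Construction: `HCBand.Node`, the targets `firstT/n1T/n0T/swNext`, occurrences
  `occL/firstOcc/nextOcc`, `chainStart/chainSucc`, the adjacency `HCBand.adj` (by cases on
  the tail), the weights `roWt/wt/bandW`, the matrix `bandM`, the row property `RowProp`,
  `card_node`; out- and in-neighbourhood lemmas (`adj_*`, `of_adj_*`).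
* Local analysis: `bead_pattern` — a supported cover without `2,3,4`-cycles restricts to each
  bead in one of nine explicit patterns (`PatKind`, `PatSpec`).
* Global structure of a cover (`IsCover`) under `RowProp`: `next_entry`, `no_escape`,
  `hub_return` (no leaks), `zin_of_sw_direct` / `chain_of_sw_chain` (chains are
  all-or-nothing), `pattern5`, the lanes and the use row of a block (`exists_use`,
  `use_unique`, `usePerm`), and `eq_bsucc`: a cover coincides pointwise with the structured
  successor `bsucc` of its configuration `(usePerm, switchW)`, which is `Valid`
  (`valid_config`).
* The structured cover of a valid configuration is a supported permutation: `adj_bsucc`,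
  `bsucc_surjective`, `bperm`.

The Hamiltonicity and the weight of `bperm`, and the resulting identity `entryHC_bandM`, are
in `HCBoolBandSum.lean`.

## References

* J. von zur Gathen, *Feasible arithmetic computations: Valiant's hypothesis*, J. Symbolic
  Comput. 4 (1987) 137–172, §5: Lemma 5.1, Thm. 5.6 and its proof ((10.1)–(11.3)).
* L. G. Valiant, *Completeness classes in algebra*, Proc. 11th STOC (1979), 249–261.
* P. Bürgisser, M. Clausen, M. A. Shokrollahi, *Algebraic Complexity Theory*, Springer 1997,
  Thm. (21.17), Ex. 21.8.
-/

noncomputable section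

namespace Literature.Computability.AlgebraicComplexity

namespace HCBand

universe u v

/-! ### Vertices -/

/-- The vertices of the Boolean band of an `N × N` matrix with `t` Boolean variables: four
bead nodes `bead a b i` and a detour node `zed a b` per position `(a, b)`, one hub `hub a` per
row and `t + 1` switch nodes `sw j` (von zur Gathen 1987, proof of Thm. 5.6: beads, row/column
nodes; here re-derived). [cite: vonzurGathen1987, Thm. 5.6] -/
inductive Node (N t : ℕ) : Type
  /-- the `i`-th node of the bead at position `(a, b)` (`0, 1` are the lane-0/lane-1 ports) -/
  | bead (a b : Fin N) (i : Fin 4) : Node N t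
  /-- the detour node of the bead at position `(a, b)` -/
  | zed (a b : Fin N) : Node N t
  /-- the hub of row `a` -/
  | hub (a : Fin N) : Node N t
  /-- the switch node of the Boolean variable `j` (`j = t` closes the thread) -/
  | sw (j : Fin (t + 1)) : Node N t
  deriving DecidableEq, Fintype

variable {N t : ℕ}

section Targets

variable [NeZero N]

/-- The entry point of block `b + 1`: port `0` of its first bead, or the first switch node
after the last block. [cite: vonzurGathen1987, Thm. 5.6] -/
def firstT (b : Fin N) : Node N t :=
  if h : (b : ℕ) + 1 < N then Node.bead 0 ⟨(b : ℕ) + 1, h⟩ 0 else Node.sw 0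

/-- The lane-1 target after the bead `(a, b)`: port `1` of the next bead of the block, or the
entry point of the next block after the last row. [cite: vonzurGathen1987, Thm. 5.6] -/
def n1T (a b : Fin N) : Node N t :=
  if h : (a : ℕ) + 1 < N then Node.bead ⟨(a : ℕ) + 1, h⟩ b 1 else firstT b

/-- The lane-0 target after the bead `(a, b)`: port `0` of the next bead of the block (none
after the last row: a block cannot end on lane 0). [cite: vonzurGathen1987, Thm. 5.6] -/
def n0T (a b : Fin N) : Option (Node N t) :=
  if h : (a : ℕ) + 1 < N then some (Node.bead ⟨(a : ℕ) + 1, h⟩ b 0) else none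

/-- The direct successor of the switch node `s_j`: `s_{j+1}`, and the first bead after `s_t`. [cite: vonzurGathen1987, Thm. 5.6] -/
def swNext (j : Fin (t + 1)) : Node N t :=
  if h : (j : ℕ) < t then Node.sw ⟨(j : ℕ) + 1, Nat.succ_lt_succ h⟩ else Node.bead 0 0 0

end Targets

/-! ### Occurrences of the Boolean variables and the chains -/

section Occ

variable {k : Type u} {σ : Type v}

open Classical in
/-- The occurrences of the Boolean variable `Y_j` in `A`, as a set of positions in
lexicographic order. [cite: vonzurGathen1987, Lemma 5.1] -/
def occL (A : Matrix (Fin N) (Fin N) (k ⊕ (σ ⊕ Fin t))) (j : Fin t) :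
    Finset (Lex (Fin N × Fin N)) :=
  Finset.univ.filter fun p => A (ofLex p).1 (ofLex p).2 = Sum.inr (Sum.inr j)

/-- The first occurrence of `Y_j`, if any. [cite: vonzurGathen1987, Lemma 5.1] -/
def firstOcc (A : Matrix (Fin N) (Fin N) (k ⊕ (σ ⊕ Fin t))) (j : Fin t) :
    Option (Lex (Fin N × Fin N)) :=
  if h : (occL A j).Nonempty then some ((occL A j).min' h) else none

/-- The occurrence of `Y_j` following the position `p`, if any. [cite: vonzurGathen1987, Lemma 5.1] -/
def nextOcc (A : Matrix (Fin N) (Fin N) (k ⊕ (σ ⊕ Fin t))) (j : Fin t)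
    (p : Lex (Fin N × Fin N)) : Option (Lex (Fin N × Fin N)) :=
  if h : ((occL A j).filter fun q => p < q).Nonempty then
    some (((occL A j).filter fun q => p < q).min' h) else none

/-- The detour node at a position given lexicographically. [cite: vonzurGathen1987, Thm. 5.6] -/
def zedL (p : Lex (Fin N × Fin N)) : Node N t :=
  Node.zed (ofLex p).1 (ofLex p).2

/-- The first chain node of the switch `s_j`: the detour node of the first occurrence of `Y_j`
(none for `j = t` and for variables without occurrences). [cite: vonzurGathen1987, Lemma 5.1] -/
def chainStart (A : Matrix (Fin N) (Fin N) (k ⊕ (σ ⊕ Fin t))) (j : Fin (t + 1)) :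
    Option (Node N t) :=
  if hj : (j : ℕ) < t then (firstOcc A ⟨j, hj⟩).map zedL else none

/-- The chain successor of the detour node at `(a, b)`: if `A a b = Y_j`, the detour node of
the next occurrence of `Y_j`, or the switch node `s_{j+1}` after the last one; none if `A a b`
is not a Boolean variable. [cite: vonzurGathen1987, Lemma 5.1] -/
def chainSucc (A : Matrix (Fin N) (Fin N) (k ⊕ (σ ⊕ Fin t))) (a b : Fin N) :
    Option (Node N t) :=
  match A a b with
  | Sum.inr (Sum.inr j) =>
      some (match nextOcc A j (toLex (a, b)) with
        | some q => zedL q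
        | none => Node.sw j.succ)
  | _ => none

end Occ

/-! ### Adjacency, weights, the matrix -/

section Matrix

variable [NeZero N] {k : Type u} {σ : Type v}

/-- The arcs of the Boolean band, by cases on the tail (see the module docstring for the
picture): bead arcs `p0→{p2, z, n1T}`, `p1→{p3, z, r_a}`, `p2→{p1, p0}`, `p3→{p2, n0T}`,
`z→{p3, chainSucc}`, hub arcs `r_a → n1T a b` for every `b`, switch arcs
`s_j → {swNext, chainStart}`. [cite: vonzurGathen1987, Thm. 5.6] -/
def adj (A : Matrix (Fin N) (Fin N) (k ⊕ (σ ⊕ Fin t))) : Node N t → Node N t → Prop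
  | Node.bead a b i, y =>
      if i = 0 then y = Node.bead a b 2 ∨ y = Node.zed a b ∨ y = n1T a b
      else if i = 1 then y = Node.bead a b 3 ∨ y = Node.zed a b ∨ y = Node.hub a
      else if i = 2 then y = Node.bead a b 1 ∨ y = Node.bead a b 0
      else y = Node.bead a b 2 ∨ n0T a b = some y
  | Node.zed a b, y => y = Node.bead a b 3 ∨ chainSucc A a b = some y
  | Node.hub a, y => ∃ b, y = n1T a b
  | Node.sw j, y => y = swNext j ∨ chainStart A j = some y

variable [CommSemiring k]

/-- The weight carried by the use arc `p1 → r_a` of the bead at an entry of `A`: the constant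
or `X`-variable there, and `1` at a Boolean variable (the Boolean sum is realised by the
chains, not by weights). [cite: vonzurGathen1987, Thm. 5.6] -/
def roWt : k ⊕ (σ ⊕ Fin t) → k ⊕ σ
  | Sum.inl c => Sum.inl c
  | Sum.inr (Sum.inl i) => Sum.inr i
  | Sum.inr (Sum.inr _) => Sum.inl 1

/-- The weight of an arc `x → y` of the band (meaningful on arcs only): the entry of `A` on a
use arc, `2` on the direct switch arc of a variable without occurrences, `1` otherwise. [cite: vonzurGathen1987, Thm. 5.6] -/
def wt (A : Matrix (Fin N) (Fin N) (k ⊕ (σ ⊕ Fin t))) : Node N t → Node N t → k ⊕ σ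
  | Node.bead a b _, Node.hub _ => roWt (A a b)
  | Node.sw j, Node.sw _ => if chainStart A j = none ∧ (j : ℕ) < t then Sum.inl 2 else Sum.inl 1
  | _, _ => Sum.inl 1

open Classical in
/-- The weight function of the band: `wt` on arcs, `0` off arcs. [cite: vonzurGathen1987, Thm. 5.6] -/
def bandW (A : Matrix (Fin N) (Fin N) (k ⊕ (σ ⊕ Fin t))) (x y : Node N t) : k ⊕ σ :=
  if adj A x y then wt A x y else Sum.inl 0

/-- **The Boolean band matrix** of `A`: the entry in row `y`, column `x` is the weight of the
arc `x → y` (so that `∏_x M (π x) x` is the weight of the cover `π`, the convention of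
`Matrix.hamiltonianCycleSum`). A matrix over `k ∪ {X_i}`. [cite: vonzurGathen1987, Thm. 5.6] -/
def bandM (A : Matrix (Fin N) (Fin N) (k ⊕ (σ ⊕ Fin t))) : Matrix (Node N t) (Node N t) (k ⊕ σ) :=
  Matrix.of fun y x => bandW A x y

end Matrix

/-- The row property: every row of `A` contains at most one Boolean variable (the transpose of
the column property (D) of BCS 1997, Thm. (21.27), restricted to the `Y`-variables). [cite: BurgisserClausenShokrollahi1997, Thm. (21.27) (D)] -/
def RowProp {k : Type u} {σ : Type v} (A : Matrix (Fin N) (Fin N) (k ⊕ (σ ⊕ Fin t))) : Prop :=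
  ∀ a b b' (j j' : Fin t), A a b = Sum.inr (Sum.inr j) → A a b' = Sum.inr (Sum.inr j') → b = b'

/-! ### Size -/

/-- The band has `5 N² + N + (t + 1)` vertices. [cite: vonzurGathen1987, Thm. 5.6] -/
theorem card_node (N t : ℕ) : Fintype.card (Node N t) = 5 * N ^ 2 + N + (t + 1) := by
  -- count along the evident equivalence with a sum of products of `Fin`s
  let e : Node N t ≃ (Fin N × Fin N × Fin 4) ⊕ (Fin N × Fin N) ⊕ Fin N ⊕ Fin (t + 1) :=
    { toFun := fun x => match x with
        | Node.bead a b i => Sum.inl (a, b, i)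
        | Node.zed a b => Sum.inr (Sum.inl (a, b))
        | Node.hub a => Sum.inr (Sum.inr (Sum.inl a))
        | Node.sw j => Sum.inr (Sum.inr (Sum.inr j))
      invFun := fun y => match y with
        | Sum.inl (a, b, i) => Node.bead a b i
        | Sum.inr (Sum.inl (a, b)) => Node.zed a b
        | Sum.inr (Sum.inr (Sum.inl a)) => Node.hub a
        | Sum.inr (Sum.inr (Sum.inr j)) => Node.sw j
      left_inv := fun x => by cases x <;> rfl
      right_inv := fun y => by rcases y with ⟨a, b, i⟩ | ⟨a, b⟩ | a | j <;> rfl }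
  rw [Fintype.card_congr e]
  simp only [Fintype.card_sum, Fintype.card_prod, Fintype.card_fin]
  ring

/-! ### Out-neighbourhoods (definitional) -/

section Adj

variable [NeZero N] {k : Type u} {σ : Type v} (A : Matrix (Fin N) (Fin N) (k ⊕ (σ ⊕ Fin t)))

/-- Arcs out of port `0`: `p0 → p2`, `p0 → z`, `p0 → n1T`. [cite: vonzurGathen1987, Thm. 5.6] -/
@[simp] theorem adj_bead0 (a b : Fin N) (y : Node N t) :
    adj A (Node.bead a b 0) y ↔ (y = Node.bead a b 2 ∨ y = Node.zed a b ∨ y = n1T a b) := by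
  simp [adj]

/-- Arcs out of port `1`: `p1 → p3`, `p1 → z`, `p1 → r_a`. [cite: vonzurGathen1987, Thm. 5.6] -/
@[simp] theorem adj_bead1 (a b : Fin N) (y : Node N t) :
    adj A (Node.bead a b 1) y ↔ (y = Node.bead a b 3 ∨ y = Node.zed a b ∨ y = Node.hub a) := by
  simp [adj]

/-- Arcs out of `p2`: `p2 → p1`, `p2 → p0`. [cite: vonzurGathen1987, Thm. 5.6] -/
@[simp] theorem adj_bead2 (a b : Fin N) (y : Node N t) :
    adj A (Node.bead a b 2) y ↔ (y = Node.bead a b 1 ∨ y = Node.bead a b 0) := by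
  simp [adj]

/-- Arcs out of `p3`: `p3 → p2`, `p3 → n0T`. [cite: vonzurGathen1987, Thm. 5.6] -/
@[simp] theorem adj_bead3 (a b : Fin N) (y : Node N t) :
    adj A (Node.bead a b 3) y ↔ (y = Node.bead a b 2 ∨ n0T a b = some y) := by
  simp [adj]

/-- Arcs out of the detour node: `z → p3`, `z → chainSucc`. [cite: vonzurGathen1987, Thm. 5.6] -/
@[simp] theorem adj_zed (a b : Fin N) (y : Node N t) :
    adj A (Node.zed a b) y ↔ (y = Node.bead a b 3 ∨ chainSucc A a b = some y) := Iff.rfl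

/-- Arcs out of the hub: `r_a → n1T a b`. [cite: vonzurGathen1987, Thm. 5.6] -/
@[simp] theorem adj_hub (a : Fin N) (y : Node N t) :
    adj A (Node.hub a) y ↔ ∃ b, y = n1T a b := Iff.rfl

/-- Arcs out of a switch node: `s_j → swNext j`, `s_j → chainStart j`. [cite: vonzurGathen1987, Thm. 5.6] -/
@[simp] theorem adj_sw (j : Fin (t + 1)) (y : Node N t) :
    adj A (Node.sw j) y ↔ (y = swNext j ∨ chainStart A j = some y) := Iff.rfl

/-! ### Shapes of the targets -/

/-- `n1T a b` is a port `1` or an entry point: never a `p2`, `p3`, detour node or hub. [cite: vonzurGathen1987, Thm. 5.6] -/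
theorem n1T_shape (a b : Fin N) :
    (∃ a' : Fin N, (a' : ℕ) = a + 1 ∧ (n1T a b : Node N t) = Node.bead a' b 1) ∨
      ((a : ℕ) + 1 = N ∧ (n1T a b : Node N t) = firstT b) := by
  unfold n1T
  split_ifs with h
  · exact Or.inl ⟨⟨a + 1, h⟩, rfl, rfl⟩
  · exact Or.inr ⟨by omega, rfl⟩

/-- `firstT b` is port `0` of the first bead of block `b + 1`, or `s_0` after the last block. [cite: vonzurGathen1987, Thm. 5.6] -/
theorem firstT_shape (b : Fin N) :
    (∃ b' : Fin N, (b' : ℕ) = b + 1 ∧ (firstT b : Node N t) = Node.bead 0 b' 0) ∨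
      ((b : ℕ) + 1 = N ∧ (firstT b : Node N t) = Node.sw 0) := by
  unfold firstT
  split_ifs with h
  · exact Or.inl ⟨⟨b + 1, h⟩, rfl, rfl⟩
  · exact Or.inr ⟨by omega, rfl⟩

/-- `firstT` is injective. [cite: vonzurGathen1987, Thm. 5.6] -/
theorem firstT_injective : Function.Injective (firstT (N := N) (t := t)) := by
  intro b b' h
  rcases firstT_shape (t := t) b with ⟨c, hc, h1⟩ | ⟨hb, h1⟩ <;>
    rcases firstT_shape (t := t) b' with ⟨c', hc', h2⟩ | ⟨hb', h2⟩ <;> rw [h1, h2] at h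
  · simp only [Node.bead.injEq, true_and, and_true] at h
    exact Fin.ext (by rw [h] at hc; omega)
  · simp at h
  · simp at h
  · exact Fin.ext (by omega)

/-- `n1T a` is injective in the block index. [cite: vonzurGathen1987, Thm. 5.6] -/
theorem n1T_injective (a : Fin N) : Function.Injective (n1T (N := N) (t := t) a) := by
  intro b b' h
  unfold n1T at h
  split_ifs at h with h1
  · simpa using h
  · exact firstT_injective h

/-- `n1T a b` is never a `p0` … unless it is the entry point of the next block: precisely, it is
never `p2`, `p3`, a detour node or a hub. [cite: vonzurGathen1987, Thm. 5.6] -/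
theorem n1T_ne_bead23 (a b a' b' : Fin N) (i : Fin 4) (hi : i = 2 ∨ i = 3) :
    (n1T a b : Node N t) ≠ Node.bead a' b' i := by
  rcases n1T_shape (t := t) a b with ⟨a'', _, h⟩ | ⟨_, h⟩ <;> rw [h]
  · simp only [ne_eq, Node.bead.injEq, not_and]; rintro - - rfl; simp at hi
  · rcases firstT_shape (t := t) b with ⟨b'', _, h'⟩ | ⟨_, h'⟩ <;> rw [h']
    · simp only [ne_eq, Node.bead.injEq, not_and]; rintro - - rfl; simp at hi
    · simp

/-- `n1T a b` is never a detour node. [cite: vonzurGathen1987, Thm. 5.6] -/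
theorem n1T_ne_zed (a b a' b' : Fin N) : (n1T a b : Node N t) ≠ Node.zed a' b' := by
  rcases n1T_shape (t := t) a b with ⟨a'', _, h⟩ | ⟨_, h⟩ <;> rw [h]
  · simp
  · rcases firstT_shape (t := t) b with ⟨b'', _, h'⟩ | ⟨_, h'⟩ <;> rw [h'] <;> simp

/-- `n1T a b` is never a hub. [cite: vonzurGathen1987, Thm. 5.6] -/
theorem n1T_ne_hub (a b a' : Fin N) : (n1T a b : Node N t) ≠ Node.hub a' := by
  rcases n1T_shape (t := t) a b with ⟨a'', _, h⟩ | ⟨_, h⟩ <;> rw [h]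
  · simp
  · rcases firstT_shape (t := t) b with ⟨b'', _, h'⟩ | ⟨_, h'⟩ <;> rw [h'] <;> simp

/-- When `n1T a b` is a port `0` of a bead, that bead is in row `0` (first bead of the next
block) and `(a, b)` is the last bead of block `b`. [cite: vonzurGathen1987, Thm. 5.6] -/
theorem n1T_eq_bead0 {a b a' b' : Fin N} (h : (n1T a b : Node N t) = Node.bead a' b' 0) :
    (a : ℕ) + 1 = N ∧ (a' : ℕ) = 0 ∧ (b' : ℕ) = b + 1 := by
  rcases n1T_shape (t := t) a b with ⟨a'', _, h1⟩ | ⟨ha, h1⟩ <;> rw [h1] at h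
  · simp at h
  · rcases firstT_shape (t := t) b with ⟨b'', hb, h'⟩ | ⟨_, h'⟩ <;> rw [h'] at h
    · simp only [Node.bead.injEq, and_true] at h
      obtain ⟨rfl, rfl⟩ := h
      exact ⟨ha, rfl, hb⟩
    · simp at h

/-- When `n1T a b` is a port `1` of a bead, that bead is the next one of the block. [cite: vonzurGathen1987, Thm. 5.6] -/
theorem n1T_eq_bead1 {a b a' b' : Fin N} (h : (n1T a b : Node N t) = Node.bead a' b' 1) :
    (a' : ℕ) = a + 1 ∧ b' = b := by
  rcases n1T_shape (t := t) a b with ⟨a'', ha, h1⟩ | ⟨_, h1⟩ <;> rw [h1] at h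
  · simp only [Node.bead.injEq, and_true] at h
    obtain ⟨rfl, rfl⟩ := h
    exact ⟨ha, rfl⟩
  · rcases firstT_shape (t := t) b with ⟨b'', _, h'⟩ | ⟨_, h'⟩ <;> rw [h'] at h <;> simp at h

/-- When `n1T a b` is a switch node, it is `s_0` and `(a, b)` is the very last bead. [cite: vonzurGathen1987, Thm. 5.6] -/
theorem n1T_eq_sw {a b : Fin N} {j : Fin (t + 1)} (h : (n1T a b : Node N t) = Node.sw j) :
    (a : ℕ) + 1 = N ∧ (b : ℕ) + 1 = N ∧ (j : ℕ) = 0 := by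
  rcases n1T_shape (t := t) a b with ⟨a'', _, h1⟩ | ⟨ha, h1⟩ <;> rw [h1] at h
  · simp at h
  · rcases firstT_shape (t := t) b with ⟨b'', _, h'⟩ | ⟨hb, h'⟩ <;> rw [h'] at h
    · simp at h
    · simp only [Node.sw.injEq] at h
      exact ⟨ha, hb, by rw [← h]; rfl⟩

omit [NeZero N] in
/-- `n0T a b = some y` forces `y` to be port `0` of the next bead of the block. [cite: vonzurGathen1987, Thm. 5.6] -/
theorem n0T_eq_some {a b : Fin N} {y : Node N t} (h : n0T a b = some y) :
    ∃ a' : Fin N, (a' : ℕ) = a + 1 ∧ y = Node.bead a' b 0 := by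
  unfold n0T at h
  split_ifs at h with h1
  simp only [Option.some.injEq] at h
  exact ⟨⟨a + 1, h1⟩, rfl, h.symm⟩

/-- `swNext j` is `s_{j+1}`, or port `0` of the very first bead for `j = t`. [cite: vonzurGathen1987, Thm. 5.6] -/
theorem swNext_shape (j : Fin (t + 1)) :
    (∃ j' : Fin (t + 1), (j' : ℕ) = j + 1 ∧ (swNext j : Node N t) = Node.sw j') ∨
      ((j : ℕ) = t ∧ (swNext j : Node N t) = Node.bead 0 0 0) := by
  unfold swNext
  split_ifs with h
  · exact Or.inl ⟨⟨j + 1, Nat.succ_lt_succ h⟩, rfl, rfl⟩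
  · exact Or.inr ⟨by omega, rfl⟩

omit [NeZero N] in
/-- `chainSucc A a b = some y` forces `A a b` to be a Boolean variable and `y` a detour node of a
later occurrence of it, or its closing switch node. [cite: vonzurGathen1987, Lemma 5.1] -/
theorem chainSucc_eq_some {a b : Fin N} {y : Node N t} (h : chainSucc A a b = some y) :
    ∃ j : Fin t, A a b = Sum.inr (Sum.inr j) ∧
      ((∃ q, nextOcc A j (toLex (a, b)) = some q ∧ y = zedL q) ∨
        (nextOcc A j (toLex (a, b)) = none ∧ y = Node.sw j.succ)) := by
  unfold chainSucc at h
  split at h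
  · rename_i j hj
    refine ⟨j, hj, ?_⟩
    simp only [Option.some.injEq] at h
    split at h
    · rename_i q hq; exact Or.inl ⟨q, hq, h.symm⟩
    · rename_i hq; exact Or.inr ⟨hq, h.symm⟩
  · simp at h

omit [NeZero N] in
/-- `chainStart A j = some y` forces `j < t` and `y` the detour node of the first occurrence. [cite: vonzurGathen1987, Lemma 5.1] -/
theorem chainStart_eq_some {j : Fin (t + 1)} {y : Node N t} (h : chainStart A j = some y) :
    ∃ (hj : (j : ℕ) < t) (q : Lex (Fin N × Fin N)),
      firstOcc A ⟨j, hj⟩ = some q ∧ y = zedL q := by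
  unfold chainStart at h
  split_ifs at h with hj
  refine ⟨hj, ?_⟩
  cases hq : firstOcc A ⟨j, hj⟩ with
  | none => rw [hq] at h; simp at h
  | some q => rw [hq] at h; simp only [Option.map_some, Option.some.injEq] at h; exact ⟨q, rfl, h.symm⟩

/-! ### In-neighbourhoods -/

/-- Who points at `p2`: only `p0` and `p3` of the same bead. [cite: vonzurGathen1987, Thm. 5.6] -/
theorem of_adj_bead2 {x : Node N t} {a b : Fin N} (h : adj A x (Node.bead a b 2)) :
    x = Node.bead a b 0 ∨ x = Node.bead a b 3 := by
  cases x with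
  | bead a' b' i =>
    fin_cases i <;> simp only [Fin.zero_eta, Fin.mk_one, Fin.reduceFinMk] at h ⊢
    · obtain h | h | h := (adj_bead0 A a' b' _).1 h
      · simp only [Node.bead.injEq] at h
        obtain ⟨rfl, rfl, -⟩ := h
        exact Or.inl rfl
      · simp at h
      · exact absurd h.symm (n1T_ne_bead23 _ _ _ _ _ (Or.inl rfl))
    · obtain h | h | h := (adj_bead1 A a' b' _).1 h <;> simp at h
    · obtain h | h := (adj_bead2 A a' b' _).1 h <;> simp at h
    · obtain h | h := (adj_bead3 A a' b' _).1 h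
      · simp only [Node.bead.injEq] at h
        obtain ⟨rfl, rfl, -⟩ := h
        exact Or.inr rfl
      · obtain ⟨a'', _, h''⟩ := n0T_eq_some h
        simp at h''
  | zed a' b' =>
    obtain h | h := (adj_zed A a' b' _).1 h
    · simp at h
    · obtain ⟨j, _, ⟨q, _, hq⟩ | ⟨_, hq⟩⟩ := chainSucc_eq_some A h
      · simp [zedL] at hq
      · simp at hq
  | hub a' =>
    obtain ⟨b', hb⟩ := (adj_hub A a' _).1 h
    exact absurd hb.symm (n1T_ne_bead23 _ _ _ _ _ (Or.inl rfl))
  | sw j =>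
    obtain h | h := (adj_sw A j _).1 h
    · rcases swNext_shape (N := N) j with ⟨j', _, h'⟩ | ⟨_, h'⟩ <;> rw [h'] at h <;> simp at h
    · obtain ⟨_, q, _, hq⟩ := chainStart_eq_some A h
      simp [zedL] at hq

/-- Who points at `p3`: only `p1` and the detour node of the same bead. [cite: vonzurGathen1987, Thm. 5.6] -/
theorem of_adj_bead3 {x : Node N t} {a b : Fin N} (h : adj A x (Node.bead a b 3)) :
    x = Node.bead a b 1 ∨ x = Node.zed a b := by
  cases x with
  | bead a' b' i =>
    fin_cases i <;> simp only [Fin.zero_eta, Fin.mk_one, Fin.reduceFinMk] at h ⊢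
    · obtain h | h | h := (adj_bead0 A a' b' _).1 h
      · simp at h
      · simp at h
      · exact absurd h.symm (n1T_ne_bead23 _ _ _ _ _ (Or.inr rfl))
    · obtain h | h | h := (adj_bead1 A a' b' _).1 h
      · simp only [Node.bead.injEq] at h
        obtain ⟨rfl, rfl, -⟩ := h
        exact Or.inl rfl
      · simp at h
      · simp at h
    · obtain h | h := (adj_bead2 A a' b' _).1 h <;> simp at h
    · obtain h | h := (adj_bead3 A a' b' _).1 h
      · simp at h
      · obtain ⟨a'', _, h''⟩ := n0T_eq_some h
        simp at h''
  | zed a' b' =>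
    obtain h | h := (adj_zed A a' b' _).1 h
    · simp only [Node.bead.injEq, and_true] at h
      obtain ⟨rfl, rfl⟩ := h
      exact Or.inr rfl
    · obtain ⟨j, _, ⟨q, _, hq⟩ | ⟨_, hq⟩⟩ := chainSucc_eq_some A h
      · simp [zedL] at hq
      · simp at hq
  | hub a' =>
    obtain ⟨b', hb⟩ := (adj_hub A a' _).1 h
    exact absurd hb.symm (n1T_ne_bead23 _ _ _ _ _ (Or.inr rfl))
  | sw j =>
    obtain h | h := (adj_sw A j _).1 h
    · rcases swNext_shape (N := N) j with ⟨j', _, h'⟩ | ⟨_, h'⟩ <;> rw [h'] at h <;> simp at h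
    · obtain ⟨_, q, _, hq⟩ := chainStart_eq_some A h
      simp [zedL] at hq

/-- Who points at port `0`: `p2` of the same bead, `p3` of the bead above (`n0T`), the lane-1
exit or the hub of the last bead of the previous block (`n1T`), or the closing switch node
(`swNext`). [cite: vonzurGathen1987, Thm. 5.6] -/
theorem of_adj_bead0 {x : Node N t} {a b : Fin N} (h : adj A x (Node.bead a b 0)) :
    x = Node.bead a b 2 ∨
      (∃ a', x = Node.bead a' b 3 ∧ n0T a' b = some (Node.bead a b 0 : Node N t)) ∨
      (∃ a' b', (x = Node.bead a' b' 0 ∨ x = Node.hub a') ∧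
        (n1T a' b' : Node N t) = Node.bead a b 0) ∨
      (∃ j, x = Node.sw j ∧ (swNext j : Node N t) = Node.bead a b 0) := by
  cases x with
  | bead a' b' i =>
    fin_cases i <;> simp only [Fin.zero_eta, Fin.mk_one, Fin.reduceFinMk] at h ⊢
    · obtain h | h | h := (adj_bead0 A a' b' _).1 h
      · simp at h
      · simp at h
      · exact Or.inr (Or.inr (Or.inl ⟨a', b', Or.inl rfl, h.symm⟩))
    · obtain h | h | h := (adj_bead1 A a' b' _).1 h <;> simp at h
    · obtain h | h := (adj_bead2 A a' b' _).1 h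
      · simp at h
      · simp only [Node.bead.injEq, and_true] at h
        obtain ⟨rfl, rfl⟩ := h
        exact Or.inl rfl
    · obtain h | h := (adj_bead3 A a' b' _).1 h
      · simp at h
      · obtain ⟨a'', _, h''⟩ := n0T_eq_some h
        simp only [Node.bead.injEq, and_true] at h''
        obtain ⟨rfl, rfl⟩ := h''
        exact Or.inr (Or.inl ⟨a', rfl, h⟩)
  | zed a' b' =>
    obtain h | h := (adj_zed A a' b' _).1 h
    · simp at h
    · obtain ⟨j, _, ⟨q, _, hq⟩ | ⟨_, hq⟩⟩ := chainSucc_eq_some A h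
      · simp [zedL] at hq
      · simp at hq
  | hub a' =>
    obtain ⟨b', hb⟩ := (adj_hub A a' _).1 h
    exact Or.inr (Or.inr (Or.inl ⟨a', b', Or.inr rfl, hb.symm⟩))
  | sw j =>
    obtain h | h := (adj_sw A j _).1 h
    · exact Or.inr (Or.inr (Or.inr ⟨j, rfl, h.symm⟩))
    · obtain ⟨_, q, _, hq⟩ := chainStart_eq_some A h
      simp [zedL] at hq

/-- Who points at port `1`: `p2` of the same bead, and the lane-1 exit or the hub of the bead
above (`n1T`). [cite: vonzurGathen1987, Thm. 5.6] -/
theorem of_adj_bead1 {x : Node N t} {a b : Fin N} (h : adj A x (Node.bead a b 1)) :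
    x = Node.bead a b 2 ∨
      (∃ a' b', (x = Node.bead a' b' 0 ∨ x = Node.hub a') ∧
        (n1T a' b' : Node N t) = Node.bead a b 1) := by
  cases x with
  | bead a' b' i =>
    fin_cases i <;> simp only [Fin.zero_eta, Fin.mk_one, Fin.reduceFinMk] at h ⊢
    · obtain h | h | h := (adj_bead0 A a' b' _).1 h
      · simp at h
      · simp at h
      · exact Or.inr ⟨a', b', Or.inl rfl, h.symm⟩
    · obtain h | h | h := (adj_bead1 A a' b' _).1 h <;> simp at h
    · obtain h | h := (adj_bead2 A a' b' _).1 h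
      · simp only [Node.bead.injEq, and_true] at h
        obtain ⟨rfl, rfl⟩ := h
        exact Or.inl rfl
      · simp at h
    · obtain h | h := (adj_bead3 A a' b' _).1 h
      · simp at h
      · obtain ⟨a'', _, h''⟩ := n0T_eq_some h
        simp at h''
  | zed a' b' =>
    obtain h | h := (adj_zed A a' b' _).1 h
    · simp at h
    · obtain ⟨j, _, ⟨q, _, hq⟩ | ⟨_, hq⟩⟩ := chainSucc_eq_some A h
      · simp [zedL] at hq
      · simp at hq
  | hub a' =>
    obtain ⟨b', hb⟩ := (adj_hub A a' _).1 h
    exact Or.inr ⟨a', b', Or.inr rfl, hb.symm⟩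
  | sw j =>
    obtain h | h := (adj_sw A j _).1 h
    · rcases swNext_shape (N := N) j with ⟨j', _, h'⟩ | ⟨_, h'⟩ <;> rw [h'] at h <;> simp at h
    · obtain ⟨_, q, _, hq⟩ := chainStart_eq_some A h
      simp [zedL] at hq

/-- Who points at the detour node: the two ports of its bead, the previous node of its chain
(`chainSucc`), or the opening switch node (`chainStart`). [cite: vonzurGathen1987, Lemma 5.1] -/
theorem of_adj_zed {x : Node N t} {a b : Fin N} (h : adj A x (Node.zed a b)) :
    x = Node.bead a b 0 ∨ x = Node.bead a b 1 ∨
      (∃ a' b', x = Node.zed a' b' ∧ chainSucc A a' b' = some (Node.zed a b)) ∨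
      (∃ j, x = Node.sw j ∧ chainStart A j = some (Node.zed a b)) := by
  cases x with
  | bead a' b' i =>
    fin_cases i <;> simp only [Fin.zero_eta, Fin.mk_one, Fin.reduceFinMk] at h ⊢
    · obtain h | h | h := (adj_bead0 A a' b' _).1 h
      · simp at h
      · simp only [Node.zed.injEq] at h
        obtain ⟨rfl, rfl⟩ := h
        exact Or.inl rfl
      · exact absurd h.symm (n1T_ne_zed _ _ _ _)
    · obtain h | h | h := (adj_bead1 A a' b' _).1 h
      · simp at h
      · simp only [Node.zed.injEq] at h
        obtain ⟨rfl, rfl⟩ := h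
        exact Or.inr (Or.inl rfl)
      · simp at h
    · obtain h | h := (adj_bead2 A a' b' _).1 h <;> simp at h
    · obtain h | h := (adj_bead3 A a' b' _).1 h
      · simp at h
      · obtain ⟨a'', _, h''⟩ := n0T_eq_some h
        simp at h''
  | zed a' b' =>
    obtain h | h := (adj_zed A a' b' _).1 h
    · simp at h
    · exact Or.inr (Or.inr (Or.inl ⟨a', b', rfl, h⟩))
  | hub a' =>
    obtain ⟨b', hb⟩ := (adj_hub A a' _).1 h
    exact absurd hb.symm (n1T_ne_zed _ _ _ _)
  | sw j =>
    obtain h | h := (adj_sw A j _).1 h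
    · rcases swNext_shape (N := N) j with ⟨j', _, h'⟩ | ⟨_, h'⟩ <;> rw [h'] at h <;> simp at h
    · exact Or.inr (Or.inr (Or.inr ⟨j, rfl, h⟩))

/-- Who points at a hub: only ports `1` of the beads of its row. [cite: vonzurGathen1987, Thm. 5.6] -/
theorem of_adj_hub {x : Node N t} {a : Fin N} (h : adj A x (Node.hub a)) :
    ∃ b, x = Node.bead a b 1 := by
  cases x with
  | bead a' b' i =>
    fin_cases i <;> simp only [Fin.zero_eta, Fin.mk_one, Fin.reduceFinMk] at h ⊢
    · obtain h | h | h := (adj_bead0 A a' b' _).1 h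
      · simp at h
      · simp at h
      · exact absurd h.symm (n1T_ne_hub _ _ _)
    · obtain h | h | h := (adj_bead1 A a' b' _).1 h
      · simp at h
      · simp at h
      · simp only [Node.hub.injEq] at h
        subst h
        exact ⟨b', rfl⟩
    · obtain h | h := (adj_bead2 A a' b' _).1 h <;> simp at h
    · obtain h | h := (adj_bead3 A a' b' _).1 h
      · simp at h
      · obtain ⟨a'', _, h''⟩ := n0T_eq_some h
        simp at h''
  | zed a' b' =>
    obtain h | h := (adj_zed A a' b' _).1 h
    · simp at h
    · obtain ⟨j, _, ⟨q, _, hq⟩ | ⟨_, hq⟩⟩ := chainSucc_eq_some A h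
      · simp [zedL] at hq
      · simp at hq
  | hub a' =>
    obtain ⟨b', hb⟩ := (adj_hub A a' _).1 h
    exact absurd hb.symm (n1T_ne_hub _ _ _)
  | sw j =>
    obtain h | h := (adj_sw A j _).1 h
    · rcases swNext_shape (N := N) j with ⟨j', _, h'⟩ | ⟨_, h'⟩ <;> rw [h'] at h <;> simp at h
    · obtain ⟨_, q, _, hq⟩ := chainStart_eq_some A h
      simp [zedL] at hq

/-- Who points at a switch node: the lane-1 exit or the hub of the very last bead (`n1T`, only
at `s_0`), the last node of the previous chain (`chainSucc`), or the previous switch node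
(`swNext`). [cite: vonzurGathen1987, Lemma 5.1] -/
theorem of_adj_sw {x : Node N t} {j : Fin (t + 1)} (h : adj A x (Node.sw j)) :
    (∃ a b, (x = Node.bead a b 0 ∨ x = Node.hub a) ∧ (n1T a b : Node N t) = Node.sw j) ∨
      (∃ a b, x = Node.zed a b ∧ chainSucc A a b = some (Node.sw j)) ∨
      (∃ j', x = Node.sw j' ∧ (swNext j' : Node N t) = Node.sw j) := by
  cases x with
  | bead a' b' i =>
    fin_cases i <;> simp only [Fin.zero_eta, Fin.mk_one, Fin.reduceFinMk] at h ⊢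
    · obtain h | h | h := (adj_bead0 A a' b' _).1 h
      · simp at h
      · simp at h
      · exact Or.inl ⟨a', b', Or.inl rfl, h.symm⟩
    · obtain h | h | h := (adj_bead1 A a' b' _).1 h <;> simp at h
    · obtain h | h := (adj_bead2 A a' b' _).1 h <;> simp at h
    · obtain h | h := (adj_bead3 A a' b' _).1 h
      · simp at h
      · obtain ⟨a'', _, h''⟩ := n0T_eq_some h
        simp at h''
  | zed a' b' =>
    obtain h | h := (adj_zed A a' b' _).1 h
    · simp at h
    · exact Or.inr (Or.inl ⟨a', b', rfl, h⟩)
  | hub a' =>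
    obtain ⟨b', hb⟩ := (adj_hub A a' _).1 h
    exact Or.inl ⟨a', b', Or.inr rfl, hb.symm⟩
  | sw j' =>
    obtain h | h := (adj_sw A j' _).1 h
    · exact Or.inr (Or.inr ⟨j', rfl, h.symm⟩)
    · obtain ⟨_, q, _, hq⟩ := chainStart_eq_some A h
      simp [zedL] at hq

/-! ### Meaning of the targets on the chain side -/

omit [NeZero N] in
/-- `zedL` is injective. [cite: vonzurGathen1987, Thm. 5.6] -/
theorem zedL_injective : Function.Injective (zedL (N := N) (t := t)) := by
  intro p q h
  simp only [zedL, Node.zed.injEq] at h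
  exact (Prod.ext_iff.2 ⟨h.1, h.2⟩ : ofLex p = ofLex q)

omit [NeZero N] in
/-- A chain arc into the detour node of `(a, b)` comes from the previous occurrence of the same
variable. [cite: vonzurGathen1987, Lemma 5.1] -/
theorem chainSucc_eq_some_zed {a b a' b' : Fin N}
    (h : chainSucc A a' b' = some (Node.zed a b)) :
    ∃ j : Fin t, A a' b' = Sum.inr (Sum.inr j) ∧ nextOcc A j (toLex (a', b')) = some (toLex (a, b)) := by
  obtain ⟨j, hj, ⟨q, hq, h⟩ | ⟨_, h⟩⟩ := chainSucc_eq_some A h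
  · refine ⟨j, hj, ?_⟩
    rw [hq]
    have : q = toLex (a, b) := zedL_injective (h.symm.trans rfl)
    rw [this]
  · simp at h

omit [NeZero N] in
/-- A chain arc into a switch node `s_j` comes from the last occurrence of `Y_{j-1}`. [cite: vonzurGathen1987, Lemma 5.1] -/
theorem chainSucc_eq_some_sw {a' b' : Fin N} {j : Fin (t + 1)}
    (h : chainSucc A a' b' = some (Node.sw j)) :
    ∃ j' : Fin t, A a' b' = Sum.inr (Sum.inr j') ∧ nextOcc A j' (toLex (a', b')) = none ∧
      j = j'.succ := by
  obtain ⟨j', hj, ⟨q, _, h⟩ | ⟨hq, h⟩⟩ := chainSucc_eq_some A h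
  · simp [zedL] at h
  · simp only [Node.sw.injEq] at h
    exact ⟨j', hj, hq, h⟩

omit [NeZero N] in
/-- An opening arc into the detour node of `(a, b)` comes from the switch of a variable whose
first occurrence is `(a, b)`. [cite: vonzurGathen1987, Lemma 5.1] -/
theorem chainStart_eq_some_zed {a b : Fin N} {j : Fin (t + 1)}
    (h : chainStart A j = some (Node.zed a b)) :
    ∃ hj : (j : ℕ) < t, firstOcc A ⟨j, hj⟩ = some (toLex (a, b)) := by
  obtain ⟨hj, q, hq, h⟩ := chainStart_eq_some A h
  refine ⟨hj, ?_⟩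
  rw [hq]
  have : q = toLex (a, b) := zedL_injective (h.symm.trans rfl)
  rw [this]

/-- `swNext j' = sw j` forces `j = j' + 1`. [cite: vonzurGathen1987, Thm. 5.6] -/
theorem swNext_eq_sw {j j' : Fin (t + 1)} (h : (swNext j' : Node N t) = Node.sw j) :
    (j : ℕ) = j' + 1 := by
  rcases swNext_shape (N := N) j' with ⟨j'', hj, h'⟩ | ⟨_, h'⟩ <;> rw [h'] at h
  · simp only [Node.sw.injEq] at h
    rw [← h]; exact hj
  · simp at h

/-- `swNext j = bead a b 0` forces `j = t` and `(a, b) = (0, 0)`. [cite: vonzurGathen1987, Thm. 5.6] -/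
theorem swNext_eq_bead {j : Fin (t + 1)} {a b : Fin N} {i : Fin 4}
    (h : (swNext j : Node N t) = Node.bead a b i) :
    (j : ℕ) = t ∧ (a : ℕ) = 0 ∧ (b : ℕ) = 0 ∧ i = 0 := by
  rcases swNext_shape (N := N) j with ⟨j'', _, h'⟩ | ⟨hj, h'⟩ <;> rw [h'] at h
  · simp at h
  · simp only [Node.bead.injEq] at h
    obtain ⟨h1, h2, h3⟩ := h
    exact ⟨hj, by rw [← h1]; simp, by rw [← h2]; simp, h3.symm⟩

end Adj

/-! ### The local analysis of one bead

For a supported cover `π` (every `x ↦ π x` is an arc) without cycles of length `≤ 4`, the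
restriction to a bead is one of nine explicit patterns (found by exhaustive enumeration of the
`16` local solutions of the bead, `9` of them without an internal cycle): the five INTENDED
ones `L0c, L0z, Uz, L1c, L1z` and four HYBRIDS `H7, H1, H2` (a second strand, fed by the chain
through `z`, leaves through the bead) and `E16` (the bead's strand escapes into the chain).
The hybrids are excluded globally in `HCBoolBandStructure`. -/

/-- Names of the nine cycle-free local patterns of a bead. [cite: vonzurGathen1987, Thm. 5.6] -/
inductive PatKind
  | L0c | L0z | H7 | Uz | H1 | E16 | L1c | L1z | H2
  deriving DecidableEq

section Local

variable [NeZero N] {k : Type u} {σ : Type v} (A : Matrix (Fin N) (Fin N) (k ⊕ (σ ⊕ Fin t)))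
variable (π : Equiv.Perm (Node N t))

/-- The nine cycle-free local patterns of the bead at `(a, b)`, as conditions on the cover `π`
(`p_i = bead a b i`, `z = zed a b`): lane-0 entry `π p2 = p1` with `L0c` (chain passes through
`z`), `L0z`, `Uz` (use), and the fed hybrids `H7`, `H1`; lane-1 entry `π p2 = p0` with the
escape `E16`, `L1c`, `L1z` and the fed hybrid `H2`. [cite: vonzurGathen1987, Thm. 5.6] -/
def PatSpec (a b : Fin N) : PatKind → Prop
  | .L0c => π (.bead a b 0) = .bead a b 2 ∧ π (.bead a b 2) = .bead a b 1 ∧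
      π (.bead a b 1) = .bead a b 3 ∧ n0T a b = some (π (.bead a b 3)) ∧
      π.symm (.zed a b) ≠ .bead a b 0 ∧ π.symm (.zed a b) ≠ .bead a b 1 ∧ π (.zed a b) ≠ .bead a b 3
  | .L0z => π (.bead a b 0) = .bead a b 2 ∧ π (.bead a b 2) = .bead a b 1 ∧
      π (.bead a b 1) = .zed a b ∧ π (.zed a b) = .bead a b 3 ∧ n0T a b = some (π (.bead a b 3))
  | .H7 => π (.bead a b 0) = .bead a b 2 ∧ π (.bead a b 2) = .bead a b 1 ∧
      π (.bead a b 1) = .hub a ∧ π (.zed a b) = .bead a b 3 ∧ n0T a b = some (π (.bead a b 3)) ∧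
      π.symm (.zed a b) ≠ .bead a b 0 ∧ π.symm (.zed a b) ≠ .bead a b 1
  | .Uz => π (.bead a b 0) = .zed a b ∧ π (.zed a b) = .bead a b 3 ∧
      π (.bead a b 3) = .bead a b 2 ∧ π (.bead a b 2) = .bead a b 1 ∧ π (.bead a b 1) = .hub a
  | .H1 => π (.bead a b 0) = n1T a b ∧ π (.bead a b 3) = .bead a b 2 ∧
      π (.bead a b 2) = .bead a b 1 ∧ π (.bead a b 1) = .hub a ∧ π (.zed a b) = .bead a b 3 ∧
      π.symm (.zed a b) ≠ .bead a b 0 ∧ π.symm (.zed a b) ≠ .bead a b 1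
  | .E16 => π (.bead a b 2) = .bead a b 0 ∧ π (.bead a b 1) = .bead a b 3 ∧
      π (.bead a b 3) = .bead a b 2 ∧ π (.bead a b 0) = .zed a b ∧ π (.zed a b) ≠ .bead a b 3
  | .L1c => π (.bead a b 2) = .bead a b 0 ∧ π (.bead a b 1) = .bead a b 3 ∧
      π (.bead a b 3) = .bead a b 2 ∧ π (.bead a b 0) = n1T a b ∧
      π.symm (.zed a b) ≠ .bead a b 0 ∧ π.symm (.zed a b) ≠ .bead a b 1 ∧ π (.zed a b) ≠ .bead a b 3
  | .L1z => π (.bead a b 2) = .bead a b 0 ∧ π (.bead a b 1) = .zed a b ∧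
      π (.zed a b) = .bead a b 3 ∧ π (.bead a b 3) = .bead a b 2 ∧ π (.bead a b 0) = n1T a b
  | .H2 => π (.bead a b 2) = .bead a b 0 ∧ π (.bead a b 1) = .hub a ∧
      π (.zed a b) = .bead a b 3 ∧ π (.bead a b 3) = .bead a b 2 ∧ π (.bead a b 0) = n1T a b ∧
      π.symm (.zed a b) ≠ .bead a b 0 ∧ π.symm (.zed a b) ≠ .bead a b 1

variable {A π}

/-- **The local classification.** In a supported cover without cycles of length `2, 3, 4`, every
bead is in one of the nine patterns `PatSpec`. [cite: vonzurGathen1987, Thm. 5.6] -/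
theorem bead_pattern (hs : ∀ x, adj A x (π x)) (h2 : ∀ x, π (π x) ≠ x)
    (h3 : ∀ x, π (π (π x)) ≠ x) (h4 : ∀ x, π (π (π (π x))) ≠ x) (a b : Fin N) :
    ∃ κ, PatSpec π a b κ := by
  -- out-options
  have o0 := (adj_bead0 A a b _).1 (hs (.bead a b 0))
  have o1 := (adj_bead1 A a b _).1 (hs (.bead a b 1))
  have o2 := (adj_bead2 A a b _).1 (hs (.bead a b 2))
  have o3 := (adj_bead3 A a b _).1 (hs (.bead a b 3))
  -- in-options (at the preimages)
  have hpre : ∀ y, adj A (π.symm y) y := fun y => by simpa using hs (π.symm y)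
  have i2 : π (.bead a b 0) = .bead a b 2 ∨ π (.bead a b 3) = .bead a b 2 := by
    rcases of_adj_bead2 A (hpre (.bead a b 2)) with h | h
    · exact Or.inl (by rw [← h]; simp)
    · exact Or.inr (by rw [← h]; simp)
  have i3 : π (.bead a b 1) = .bead a b 3 ∨ π (.zed a b) = .bead a b 3 := by
    rcases of_adj_bead3 A (hpre (.bead a b 3)) with h | h
    · exact Or.inl (by rw [← h]; simp)
    · exact Or.inr (by rw [← h]; simp)
  have inj : ∀ {x y}, π x = π y → x = y := fun h => π.injective h
  -- `π.symm z ≠ p` from `π p ≠ z`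
  have nz : ∀ {p : Node N t}, π p ≠ .zed a b → π.symm (.zed a b) ≠ p := by
    intro p hp h; apply hp; rw [← h]; simp
  rcases o2 with c2 | c2
  · -- lane-0 entry
    rcases o0 with c0 | c0 | c0
    · -- `p0 → p2`: bypass on lane 0
      have c3 : n0T a b = some (π (.bead a b 3)) := by
        rcases o3 with h | h
        · exact absurd (inj (h.trans c0.symm)) (by simp)
        · exact h
      rcases o1 with c1 | c1 | c1
      · refine ⟨PatKind.L0c, c0, c2, c1, c3, nz (by rw [c0]; simp), nz (by rw [c1]; simp), ?_⟩
        intro hz; exact absurd (inj (hz.trans c1.symm)) (by simp)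
      · have cz : π (.zed a b) = .bead a b 3 := by
          rcases i3 with h | h
          · rw [c1] at h; simp at h
          · exact h
        exact ⟨PatKind.L0z, c0, c2, c1, cz, c3⟩
      · have cz : π (.zed a b) = .bead a b 3 := by
          rcases i3 with h | h
          · rw [c1] at h; simp at h
          · exact h
        exact ⟨PatKind.H7, c0, c2, c1, cz, c3, nz (by rw [c0]; simp), nz (by rw [c1]; simp)⟩
    · -- `p0 → z`: use, or an escape closing a 3-cycle
      rcases i3 with c1 | cz
      · have c3 : π (.bead a b 3) = .bead a b 2 := by
          rcases i2 with h | h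
          · rw [c0] at h; simp at h
          · exact h
        exact absurd (by rw [c1, c3, c2] : π (π (π (.bead a b 1))) = .bead a b 1) (h3 _)
      · have c3 : π (.bead a b 3) = .bead a b 2 := by
          rcases i2 with h | h
          · rw [c0] at h; simp at h
          · exact h
        rcases o1 with c1 | c1 | c1
        · exact absurd (inj (c1.trans cz.symm)) (by simp)
        · exact absurd (inj (c1.trans c0.symm)) (by simp)
        · exact ⟨PatKind.Uz, c0, cz, c3, c2, c1⟩
    · -- `p0 → n1T`: immediate lane switch, only as a fed hybrid
      have c3 : π (.bead a b 3) = .bead a b 2 := by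
        rcases i2 with h | h
        · rw [c0] at h; exact absurd h (n1T_ne_bead23 _ _ _ _ _ (Or.inl rfl))
        · exact h
      rcases o1 with c1 | c1 | c1
      · exact absurd (by rw [c1, c3, c2] : π (π (π (.bead a b 1))) = .bead a b 1) (h3 _)
      · have cz : π (.zed a b) = .bead a b 3 := by
          rcases i3 with h | h
          · rw [c1] at h; simp at h
          · exact h
        exact absurd (by rw [c1, cz, c3, c2] : π (π (π (π (.bead a b 1)))) = .bead a b 1) (h4 _)
      · have cz : π (.zed a b) = .bead a b 3 := by
          rcases i3 with h | h
          · rw [c1] at h; simp at h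
          · exact h
        exact ⟨PatKind.H1, c0, c3, c2, c1, cz, nz (by rw [c0]; exact n1T_ne_zed _ _ _ _),
          nz (by rw [c1]; simp)⟩
  · -- lane-1 entry
    rcases o1 with c1 | c1 | c1
    · -- `p1 → p3`
      rcases o0 with c0 | c0 | c0
      · exact absurd (by rw [c0, c2] : π (π (.bead a b 0)) = .bead a b 0) (h2 _)
      · have c3 : π (.bead a b 3) = .bead a b 2 := by
          rcases i2 with h | h
          · rw [c0] at h; simp at h
          · exact h
        refine ⟨PatKind.E16, c2, c1, c3, c0, ?_⟩
        intro hz; exact absurd (inj (hz.trans c1.symm)) (by simp)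
      · have c3 : π (.bead a b 3) = .bead a b 2 := by
          rcases i2 with h | h
          · rw [c0] at h; exact absurd h (n1T_ne_bead23 _ _ _ _ _ (Or.inl rfl))
          · exact h
        refine ⟨PatKind.L1c, c2, c1, c3, c0, nz (by rw [c0]; exact n1T_ne_zed _ _ _ _),
          nz (by rw [c1]; simp), ?_⟩
        intro hz; exact absurd (inj (hz.trans c1.symm)) (by simp)
    · -- `p1 → z`
      have cz : π (.zed a b) = .bead a b 3 := by
        rcases i3 with h | h
        · rw [c1] at h; simp at h
        · exact h
      rcases o0 with c0 | c0 | c0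
      · exact absurd (by rw [c0, c2] : π (π (.bead a b 0)) = .bead a b 0) (h2 _)
      · exact absurd (inj (c0.trans c1.symm)) (by simp)
      · have c3 : π (.bead a b 3) = .bead a b 2 := by
          rcases i2 with h | h
          · rw [c0] at h; exact absurd h (n1T_ne_bead23 _ _ _ _ _ (Or.inl rfl))
          · exact h
        exact ⟨PatKind.L1z, c2, c1, cz, c3, c0⟩
    · -- `p1 → hub`
      have cz : π (.zed a b) = .bead a b 3 := by
        rcases i3 with h | h
        · rw [c1] at h; simp at h
        · exact h
      rcases o0 with c0 | c0 | c0
      · exact absurd (by rw [c0, c2] : π (π (.bead a b 0)) = .bead a b 0) (h2 _)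
      · have c3 : π (.bead a b 3) = .bead a b 2 := by
          rcases i2 with h | h
          · rw [c0] at h; simp at h
          · exact h
        exact absurd (by rw [c0, cz, c3, c2] : π (π (π (π (.bead a b 0)))) = .bead a b 0) (h4 _)
      · have c3 : π (.bead a b 3) = .bead a b 2 := by
          rcases i2 with h | h
          · rw [c0] at h; exact absurd h (n1T_ne_bead23 _ _ _ _ _ (Or.inl rfl))
          · exact h
        exact ⟨PatKind.H2, c2, c1, cz, c3, c0, nz (by rw [c0]; exact n1T_ne_zed _ _ _ _),
          nz (by rw [c1]; simp)⟩

end Local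

/-! ### Global structure I: covers, entry of the next unit, no escapes, no leaks -/

section Global

variable [NeZero N] {k : Type u} {σ : Type v} {A : Matrix (Fin N) (Fin N) (k ⊕ (σ ⊕ Fin t))}
variable {π : Equiv.Perm (Node N t)}

/-- A *cover* of the band: a permutation supported on the arcs, without cycles of length
`2, 3, 4` (consequences of being a single Hamiltonian cycle on `≥ 5` vertices). [cite: vonzurGathen1987, Thm. 5.6] -/
structure IsCover (A : Matrix (Fin N) (Fin N) (k ⊕ (σ ⊕ Fin t))) (π : Equiv.Perm (Node N t)) :
    Prop where
  /-- every step of `π` is an arc -/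
  adj : ∀ x, adj A x (π x)
  /-- no `2`-cycles -/
  two : ∀ x, π (π x) ≠ x
  /-- no `3`-cycles -/
  three : ∀ x, π (π (π x)) ≠ x
  /-- no `4`-cycles -/
  four : ∀ x, π (π (π (π x))) ≠ x

omit [NeZero N] in
/-- From `π.symm y = x` to `π x = y`. [folklore] -/
theorem apply_of_symm_eq {x y : Node N t} (h : π.symm y = x) : π x = y :=
  (π.symm_apply_eq.1 h).symm

namespace IsCover

variable (hc : IsCover A π)
include hc

/-- Every step into `y` is an arc from `π⁻¹ y`. [cite: vonzurGathen1987, Thm. 5.6] -/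
theorem adj_symm (y : Node N t) : HCBand.adj A (π.symm y) y := by
  simpa using hc.adj (π.symm y)

/-- The local classification at every bead. [cite: vonzurGathen1987, Thm. 5.6] -/
theorem pattern (a b : Fin N) : ∃ κ, PatSpec π a b κ :=
  bead_pattern hc.adj hc.two hc.three hc.four a b

/-- Port exclusivity: the two ports of a bead are not both entered from outside the bead
(`p2` feeds one of them). [cite: vonzurGathen1987, Thm. 5.6] -/
theorem ports_exclusive {a b : Fin N} {x y : Node N t} (hx : π x = Node.bead a b 0)
    (hy : π y = Node.bead a b 1) : x = Node.bead a b 2 ∨ y = Node.bead a b 2 := by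
  rcases (adj_bead2 A a b _).1 (hc.adj (.bead a b 2)) with h | h
  · exact Or.inr (π.injective (hy.trans h.symm))
  · exact Or.inl (π.injective (hx.trans h.symm))

/-- **Entry of the next unit.** For every position `(a, b)`, the unit threaded after it (the
next bead of the block, the first bead of the next block, or the switch section) is entered
either by the lane-1 exit of `(a, b)`, or by the hub of row `a`, or by the lane-0 exit of
`(a, b)`. [cite: vonzurGathen1987, Thm. 5.6] -/
theorem next_entry (a b : Fin N) :
    π (Node.bead a b 0) = n1T a b ∨ π (Node.hub a) = n1T a b ∨
      n0T a b = some (π (Node.bead a b 3)) := by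
  -- the two ways of concluding through `n1T`
  have key : ∀ y : Node N t, n1T a b = y →
      (π.symm y = Node.bead a b 0 ∨ π.symm y = Node.hub a) →
      π (Node.bead a b 0) = n1T a b ∨ π (Node.hub a) = n1T a b ∨
        n0T a b = some (π (Node.bead a b 3)) := by
    rintro y hy (h | h)
    · exact Or.inl ((apply_of_symm_eq h).trans hy.symm)
    · exact Or.inr (Or.inl ((apply_of_symm_eq h).trans hy.symm))
  -- lane of a bead from its pattern
  have hlane : ∀ a' b', π (.bead a' b' 2) = .bead a' b' 1 ∨ π (.bead a' b' 2) = .bead a' b' 0 := by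
    intro a' b'
    rcases (adj_bead2 A a' b' _).1 (hc.adj (.bead a' b' 2)) with h | h
    · exact Or.inl h
    · exact Or.inr h
  rcases n1T_shape (t := t) a b with ⟨a', ha', hn⟩ | ⟨ha, hn⟩
  · -- the next bead `(a', b)` of the block
    rcases hlane a' b with h2 | h2
    · -- lane 0: `p0` is entered from outside, necessarily from `p3` of `(a, b)`
      rcases of_adj_bead0 A (hc.adj_symm (.bead a' b 0)) with
        h | ⟨a'', h, hn0⟩ | ⟨a'', b'', h, hn1⟩ | ⟨j, h, hsw⟩
      · have := apply_of_symm_eq h; rw [h2] at this; simp at this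
      · obtain ⟨a3, ha3, h3⟩ := n0T_eq_some hn0
        simp only [Node.bead.injEq, and_true] at h3
        have haa : a'' = a := Fin.ext (by subst h3; omega)
        subst haa
        exact Or.inr (Or.inr (by rw [hn0, apply_of_symm_eq h]))
      · obtain ⟨-, h0, -⟩ := n1T_eq_bead0 hn1
        omega
      · obtain ⟨-, h0, -⟩ := swNext_eq_bead hsw
        omega
    · -- lane 1: `p1` is entered from outside: from `p0` of `(a, b)` or from the hub
      rcases of_adj_bead1 A (hc.adj_symm (.bead a' b 1)) with h | ⟨a'', b'', h, hn1⟩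
      · have := apply_of_symm_eq h; rw [h2] at this; simp at this
      · obtain ⟨h1, rfl⟩ := n1T_eq_bead1 hn1
        have haa : a'' = a := Fin.ext (by omega)
        subst haa
        exact key _ hn h
  · -- after the last row: the first bead of the next block, or `s_0`
    rcases firstT_shape (t := t) b with ⟨b', hb', hf⟩ | ⟨hb, hf⟩
    · rcases hlane 0 b' with h2 | h2
      · rcases of_adj_bead0 A (hc.adj_symm (.bead 0 b' 0)) with
          h | ⟨a'', h, hn0⟩ | ⟨a'', b'', h, hn1⟩ | ⟨j, h, hsw⟩
        · have := apply_of_symm_eq h; rw [h2] at this; simp at this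
        · obtain ⟨a3, ha3, h3⟩ := n0T_eq_some hn0
          simp only [Node.bead.injEq, and_true] at h3
          have : ((0 : Fin N) : ℕ) = a'' + 1 := by rw [h3]; exact ha3
          simp at this
        · obtain ⟨hN, -, hbb⟩ := n1T_eq_bead0 hn1
          have haa : a'' = a := Fin.ext (by omega)
          have hbb' : b'' = b := Fin.ext (by omega)
          subst haa; subst hbb'
          exact key _ (hn.trans hf) h
        · obtain ⟨-, -, h0, -⟩ := swNext_eq_bead hsw
          omega
      · rcases of_adj_bead1 A (hc.adj_symm (.bead 0 b' 1)) with h | ⟨a'', b'', h, hn1⟩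
        · have := apply_of_symm_eq h; rw [h2] at this; simp at this
        · obtain ⟨h1, -⟩ := n1T_eq_bead1 hn1
          simp at h1
    · rcases of_adj_sw A (hc.adj_symm (.sw 0)) with
        ⟨a'', b'', h, hn1⟩ | ⟨a'', b'', h, hcs⟩ | ⟨j', h, hsw⟩
      · obtain ⟨hN, hbN, -⟩ := n1T_eq_sw hn1
        have haa : a'' = a := Fin.ext (by omega)
        have hbb' : b'' = b := Fin.ext (by omega)
        subst haa; subst hbb'
        exact key _ (hn.trans hf) h
      · obtain ⟨j', _, _, hj⟩ := chainSucc_eq_some_sw A hcs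
        exact absurd (congrArg Fin.val hj) (by simp)
      · have := swNext_eq_sw hsw
        simp at this

/-- A detour node entered from outside its bead lies at an occurrence of a Boolean variable
(its chain predecessors exist only then). [cite: vonzurGathen1987, Lemma 5.1] -/
theorem isY_of_fed {a b : Fin N} (h0 : π.symm (Node.zed a b) ≠ Node.bead a b 0)
    (h1 : π.symm (Node.zed a b) ≠ Node.bead a b 1) :
    ∃ j : Fin t, A a b = Sum.inr (Sum.inr j) := by
  rcases of_adj_zed A (hc.adj_symm (.zed a b)) with h | h | ⟨a', b', _, hcs⟩ | ⟨j, _, hst⟩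
  · exact absurd h h0
  · exact absurd h h1
  · obtain ⟨j, _, hn⟩ := chainSucc_eq_some_zed A hcs
    have hm : toLex (a, b) ∈ occL A j := by
      unfold nextOcc at hn
      split_ifs at hn with hne
      simp only [Option.some.injEq] at hn
      rw [← hn]
      exact (Finset.mem_filter.1 (Finset.min'_mem _ hne)).1
    exact ⟨j, by simpa [occL] using hm⟩
  · obtain ⟨hj, hf⟩ := chainStart_eq_some_zed A hst
    have hm : toLex (a, b) ∈ occL A ⟨j, hj⟩ := by
      unfold firstOcc at hf
      split_ifs at hf with hne
      simp only [Option.some.injEq] at hf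
      rw [← hf]
      exact Finset.min'_mem _ hne
    exact ⟨⟨j, hj⟩, by simpa [occL] using hm⟩

/-- A detour node that is not exited into its bead lies at an occurrence of a Boolean
variable. [cite: vonzurGathen1987, Lemma 5.1] -/
theorem isY_of_zed_out {a b : Fin N} (h : π (Node.zed a b) ≠ Node.bead a b 3) :
    ∃ j : Fin t, A a b = Sum.inr (Sum.inr j) := by
  rcases (adj_zed A a b _).1 (hc.adj (.zed a b)) with h' | h'
  · exact absurd h' h
  · obtain ⟨j, hj, _⟩ := chainSucc_eq_some A h'
    exact ⟨j, hj⟩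

/-- **No escapes.** Under the row property, no bead is in the escape pattern `E16` (its
strand cannot leave into a chain: the hub of its row would have to return to it, but it is
fed by another bead of the row, behind which the block starves). [cite: vonzurGathen1987, Thm. 5.6] -/
theorem no_escape (hrow : RowProp A) (a b : Fin N) : ¬ PatSpec π a b .E16 := by
  rintro ⟨c2, c1, c3, c0, cz⟩
  -- the unit after `(a, b)` must be entered through the hub of row `a`
  have hhub : π (Node.hub a) = n1T a b := by
    rcases hc.next_entry a b with h | h | h
    · rw [c0] at h; exact absurd h.symm (n1T_ne_zed _ _ _ _)
    · exact h
    · rw [c3] at h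
      obtain ⟨a', _, h'⟩ := n0T_eq_some h
      simp at h'
  -- the hub is fed by another bead `(a, b')` of the row
  obtain ⟨b', hb'⟩ := of_adj_hub A (hc.adj_symm (.hub a))
  have hp1 : π (Node.bead a b' 1) = Node.hub a := apply_of_symm_eq hb'
  have hne : b' ≠ b := by
    rintro rfl; rw [c1] at hp1; simp at hp1
  -- `(a, b)` holds a Boolean variable, so `(a, b')` does not
  obtain ⟨j, hj⟩ := hc.isY_of_zed_out cz
  have hnY : ∀ j' : Fin t, A a b' ≠ Sum.inr (Sum.inr j') := fun j' h =>
    hne (hrow a b b' j j' hj h).symm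
  -- hence `(a, b')` is in the use pattern `Uz`
  obtain ⟨κ, hκ⟩ := hc.pattern a b'
  have hUz : π (Node.bead a b' 0) = Node.zed a b' ∧ π (Node.bead a b' 3) = Node.bead a b' 2 := by
    cases κ <;> simp only [PatSpec] at hκ
    · rw [hκ.2.2.1] at hp1; simp at hp1
    · rw [hκ.2.2.1] at hp1; simp at hp1
    · obtain ⟨j', hj'⟩ := hc.isY_of_fed hκ.2.2.2.2.2.1 hκ.2.2.2.2.2.2; exact absurd hj' (hnY j')
    · exact ⟨hκ.1, hκ.2.2.1⟩
    · obtain ⟨j', hj'⟩ := hc.isY_of_fed hκ.2.2.2.2.2.1 hκ.2.2.2.2.2.2; exact absurd hj' (hnY j')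
    · rw [hκ.2.1] at hp1; simp at hp1
    · rw [hκ.2.1] at hp1; simp at hp1
    · rw [hκ.2.1] at hp1; simp at hp1
    · obtain ⟨j', hj'⟩ := hc.isY_of_fed hκ.2.2.2.2.2.1 hκ.2.2.2.2.2.2; exact absurd hj' (hnY j')
  -- and the unit after `(a, b')` starves
  rcases hc.next_entry a b' with h | h | h
  · rw [hUz.1] at h; exact absurd h.symm (n1T_ne_zed _ _ _ _)
  · rw [hhub] at h; exact hne (n1T_injective a h).symm
  · rw [hUz.2] at h
    obtain ⟨a', _, h'⟩ := n0T_eq_some h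
    simp at h'

/-- **No leaks.** Under the row property, the hub entered from the bead `(a, b)` returns to
the block `b`: `π (hub a) = n1T a b`. [cite: vonzurGathen1987, Thm. 5.6] -/
theorem hub_return (hrow : RowProp A) {a b : Fin N} (h : π (Node.bead a b 1) = Node.hub a) :
    π (Node.hub a) = n1T a b := by
  obtain ⟨b'', hb''⟩ := (adj_hub A a _).1 (hc.adj (.hub a))
  by_contra hne
  have hbb : b'' ≠ b := by rintro rfl; exact hne hb''
  -- the bead `q = (a, b'')`, behind which the hub lands
  have h0 : π (Node.bead a b'' 0) ≠ n1T a b'' := by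
    rw [← hb'']; intro h'; exact absurd (π.injective h') (by simp)
  have h3 : π (Node.bead a b'' 3) = Node.bead a b'' 2 := by
    rcases (adj_bead3 A a b'' _).1 (hc.adj (.bead a b'' 3)) with h' | h'
    · exact h'
    · obtain ⟨a', ha', hq3⟩ := n0T_eq_some h'
      -- both ports of the next bead would be entered from outside
      rcases n1T_shape (t := t) a b'' with ⟨a₁, ha₁, hn⟩ | ⟨haN, _⟩
      · have haa : a₁ = a' := Fin.ext (by omega)
        subst haa
        rcases hc.ports_exclusive hq3 (hb''.trans hn) with h'' | h'' <;> simp at h''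
      · omega
  have h0' : π (Node.bead a b'' 0) = Node.zed a b'' := by
    rcases (adj_bead0 A a b'' _).1 (hc.adj (.bead a b'' 0)) with h' | h' | h'
    · exact absurd (π.injective (h'.trans h3.symm)) (by simp)
    · exact h'
    · exact absurd h' h0
  have h1 : π (Node.bead a b'' 1) = Node.bead a b'' 3 := by
    rcases (adj_bead1 A a b'' _).1 (hc.adj (.bead a b'' 1)) with h' | h' | h'
    · exact h'
    · exact absurd (π.injective (h'.trans h0'.symm)) (by simp)
    · have := π.injective (h'.trans h.symm)
      simp only [Node.bead.injEq, true_and, and_true] at this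
      exact absurd this hbb
  have h2 : π (Node.bead a b'' 2) = Node.bead a b'' 0 := by
    rcases (adj_bead2 A a b'' _).1 (hc.adj (.bead a b'' 2)) with h' | h'
    · exact absurd (by rw [h1, h3, h'] : π (π (π (Node.bead a b'' 1))) = .bead a b'' 1)
        (hc.three _)
    · exact h'
  have hz : π (Node.zed a b'') ≠ Node.bead a b'' 3 := by
    rw [← h1]; intro h'; exact absurd (π.injective h') (by simp)
  exact hc.no_escape hrow a b'' ⟨h2, h1, h3, h0', hz⟩

/-- A bead whose detour node is entered from the bead also exits it into the bead
(`zin → zout`): the escape is excluded and all other patterns comply. [cite: vonzurGathen1987, Thm. 5.6] -/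
theorem zout_of_zin (hrow : RowProp A) {a b : Fin N}
    (h : π.symm (Node.zed a b) = Node.bead a b 0 ∨ π.symm (Node.zed a b) = Node.bead a b 1) :
    π (Node.zed a b) = Node.bead a b 3 := by
  obtain ⟨κ, hκ⟩ := hc.pattern a b
  cases κ <;> simp only [PatSpec] at hκ
  · rcases h with h | h
    · exact absurd h hκ.2.2.2.2.1
    · exact absurd h hκ.2.2.2.2.2.1
  · exact hκ.2.2.2.1
  · exact hκ.2.2.2.1
  · exact hκ.2.1
  · exact hκ.2.2.2.2.1
  · exact absurd hκ (hc.no_escape hrow a b)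
  · rcases h with h | h
    · exact absurd h hκ.2.2.2.2.1
    · exact absurd h hκ.2.2.2.2.2.1
  · exact hκ.2.2.1
  · exact hκ.2.2.1

end IsCover

end Global

/-! ### Occurrence bookkeeping -/

section OccFacts

variable {k : Type u} {σ : Type v} (A : Matrix (Fin N) (Fin N) (k ⊕ (σ ⊕ Fin t)))

/-- Membership in `occL`. [cite: vonzurGathen1987, Lemma 5.1] -/
theorem mem_occL {j : Fin t} {p : Lex (Fin N × Fin N)} :
    p ∈ occL A j ↔ A (ofLex p).1 (ofLex p).2 = Sum.inr (Sum.inr j) := by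
  simp [occL]

/-- A position holds at most one Boolean variable. [folklore] -/
theorem occL_unique {j j' : Fin t} {p : Lex (Fin N × Fin N)} (h : p ∈ occL A j)
    (h' : p ∈ occL A j') : j = j' := by
  rw [mem_occL] at h h'
  have := h.symm.trans h'
  simpa using this

/-- `firstOcc` is the least occurrence. [cite: vonzurGathen1987, Lemma 5.1] -/
theorem firstOcc_spec {j : Fin t} {q : Lex (Fin N × Fin N)} (h : firstOcc A j = some q) :
    q ∈ occL A j ∧ ∀ p ∈ occL A j, q ≤ p := by
  unfold firstOcc at h
  split_ifs at h with hne
  simp only [Option.some.injEq] at h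
  subst h
  exact ⟨Finset.min'_mem _ hne, fun p hp => Finset.min'_le _ _ hp⟩

/-- `firstOcc = none` iff there is no occurrence. [cite: vonzurGathen1987, Lemma 5.1] -/
theorem firstOcc_eq_none {j : Fin t} (h : firstOcc A j = none) (p : Lex (Fin N × Fin N)) :
    p ∉ occL A j := by
  unfold firstOcc at h
  split_ifs at h with hne
  intro hp; exact hne ⟨p, hp⟩

/-- Some occurrence forces `firstOcc` to be defined. [cite: vonzurGathen1987, Lemma 5.1] -/
theorem firstOcc_isSome {j : Fin t} {p : Lex (Fin N × Fin N)} (hp : p ∈ occL A j) :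
    ∃ q, firstOcc A j = some q := by
  cases h : firstOcc A j with
  | none => exact absurd hp (firstOcc_eq_none A h p)
  | some q => exact ⟨q, rfl⟩

/-- `nextOcc p` is the least occurrence after `p`. [cite: vonzurGathen1987, Lemma 5.1] -/
theorem nextOcc_spec {j : Fin t} {p q : Lex (Fin N × Fin N)} (h : nextOcc A j p = some q) :
    q ∈ occL A j ∧ p < q ∧ ∀ p' ∈ occL A j, p < p' → q ≤ p' := by
  unfold nextOcc at h
  split_ifs at h with hne
  simp only [Option.some.injEq] at h
  subst h
  have hm := Finset.mem_filter.1 (Finset.min'_mem _ hne)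
  exact ⟨hm.1, hm.2, fun p' hp' hlt => Finset.min'_le _ _ (Finset.mem_filter.2 ⟨hp', hlt⟩)⟩

/-- `nextOcc p = none` iff no occurrence lies after `p`. [cite: vonzurGathen1987, Lemma 5.1] -/
theorem nextOcc_eq_none {j : Fin t} {p : Lex (Fin N × Fin N)} (h : nextOcc A j p = none)
    {p' : Lex (Fin N × Fin N)} (hp' : p' ∈ occL A j) : ¬ p < p' := by
  unfold nextOcc at h
  split_ifs at h with hne
  intro hlt; exact hne ⟨p', Finset.mem_filter.2 ⟨hp', hlt⟩⟩

/-- Two occurrences with the same next occurrence coincide. [cite: vonzurGathen1987, Lemma 5.1] -/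
theorem eq_of_nextOcc_eq {j : Fin t} {p p'' q : Lex (Fin N × Fin N)} (hp : p ∈ occL A j)
    (hp'' : p'' ∈ occL A j) (h : nextOcc A j p = some q) (h'' : nextOcc A j p'' = some q) :
    p = p'' := by
  obtain ⟨_, hlt, hmin⟩ := nextOcc_spec A h
  obtain ⟨_, hlt'', hmin''⟩ := nextOcc_spec A h''
  rcases lt_trichotomy p p'' with hl | he | hg
  · exact absurd (hmin p'' hp'' hl) (not_le.2 hlt'')
  · exact he
  · exact absurd (hmin'' p hp hg) (not_le.2 hlt)

/-- Two occurrences without a next occurrence coincide (both are the last one). [cite: vonzurGathen1987, Lemma 5.1] -/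
theorem eq_of_nextOcc_none {j : Fin t} {p p'' : Lex (Fin N × Fin N)} (hp : p ∈ occL A j)
    (hp'' : p'' ∈ occL A j) (h : nextOcc A j p = none) (h'' : nextOcc A j p'' = none) :
    p = p'' := by
  rcases lt_trichotomy p p'' with hl | he | hg
  · exact absurd hl (nextOcc_eq_none A h hp'')
  · exact he
  · exact absurd hg (nextOcc_eq_none A h'' hp)

end OccFacts

/-! ### Global structure II: the chains are all-or-nothing -/

section GlobalChain

variable [NeZero N] {k : Type u} {σ : Type v} {A : Matrix (Fin N) (Fin N) (k ⊕ (σ ⊕ Fin t))}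
variable {π : Equiv.Perm (Node N t)}

/-- The successor of the detour node of the occurrence `q` along its chain: the detour node
of the next occurrence, or the closing switch node. [cite: vonzurGathen1987, Lemma 5.1] -/
def chainNext (A : Matrix (Fin N) (Fin N) (k ⊕ (σ ⊕ Fin t))) (j : Fin t)
    (q : Lex (Fin N × Fin N)) : Node N t :=
  match nextOcc A j q with
  | some q' => zedL q'
  | none => Node.sw j.succ

omit [NeZero N] in
/-- At an occurrence of `Y_j`, `chainSucc` is `chainNext`. [cite: vonzurGathen1987, Lemma 5.1] -/
theorem chainSucc_eq_chainNext {j : Fin t} {q : Lex (Fin N × Fin N)} (hq : q ∈ occL A j) :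
    chainSucc A (ofLex q).1 (ofLex q).2 = some (chainNext A j q) := by
  rw [mem_occL] at hq
  unfold chainSucc chainNext
  rw [hq]
  rfl

namespace IsCover

variable (hc : IsCover A π)
include hc

/-- **Chains switched off absorb nothing.** If the switch `s_j` takes its direct arc, the
detour node of every occurrence of `Y_j` is entered from its own bead (by induction along the
chain: nothing else can feed it). [cite: vonzurGathen1987, Lemma 5.1] -/
theorem zin_of_sw_direct (hrow : RowProp A) (j : Fin t)
    (hsw : π (Node.sw j.castSucc) = swNext j.castSucc) :
    ∀ q ∈ occL A j, (π.symm (zedL q) = Node.bead (ofLex q).1 (ofLex q).2 0 ∨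
      π.symm (zedL q) = Node.bead (ofLex q).1 (ofLex q).2 1) := by
  intro q
  induction q using WellFoundedLT.induction with
  | ind q ih =>
    intro hq
    rcases of_adj_zed A (hc.adj_symm (zedL q)) with h | h | ⟨a', b', h, hcs⟩ | ⟨j', h, hst⟩
    · exact Or.inl h
    · exact Or.inr h
    · exfalso
      obtain ⟨j', hj', hn⟩ := chainSucc_eq_some_zed A hcs
      obtain ⟨hqm, hlt, -⟩ := nextOcc_spec A hn
      have hjj : j' = j := occL_unique A hqm hq
      subst hjj
      have hp : toLex (a', b') ∈ occL A j' := (mem_occL A).2 hj'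
      have hzin := ih _ hlt hp
      have hzout := hc.zout_of_zin hrow hzin
      have := apply_of_symm_eq h
      rw [show (Node.zed a' b' : Node N t) = zedL (toLex (a', b')) from rfl] at this
      simp only [zedL, ofLex_toLex] at hzout this
      rw [hzout] at this
      exact absurd this (by simp)
    · exfalso
      obtain ⟨hj, hf⟩ := chainStart_eq_some_zed A hst
      obtain ⟨hqm, -⟩ := firstOcc_spec A hf
      have hjj : (⟨j', hj⟩ : Fin t) = j := occL_unique A hqm hq
      have hjc : j' = j.castSucc := by
        apply Fin.ext; have := congrArg Fin.val hjj; simpa using this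
      subst hjc
      have := apply_of_symm_eq h
      rw [hsw] at this
      rcases swNext_shape (N := N) j.castSucc with ⟨j'', _, h'⟩ | ⟨_, h'⟩ <;> rw [h'] at this <;>
        simp [zedL] at this

/-- **Chains switched on absorb everything.** If the switch `s_j` does not take its direct
arc, the chain of `Y_j` is traversed completely: the detour node of every occurrence is fed by
the chain and passes on along the chain (backward induction from the closing switch node).
[cite: vonzurGathen1987, Lemma 5.1] -/
theorem chain_of_sw_chain (hrow : RowProp A) (j : Fin t)
    (hsw : π (Node.sw j.castSucc) ≠ swNext j.castSucc) :
    ∀ q ∈ occL A j, π (zedL q) = chainNext A j q ∧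
      ¬ (π.symm (zedL q) = Node.bead (ofLex q).1 (ofLex q).2 0 ∨
        π.symm (zedL q) = Node.bead (ofLex q).1 (ofLex q).2 1) := by
  -- it suffices to establish the first claim: the second follows from `zin → zout`
  suffices H : ∀ q ∈ occL A j, π (zedL q) = chainNext A j q by
    intro q hq
    refine ⟨H q hq, fun hzin => ?_⟩
    have hzout := hc.zout_of_zin hrow hzin
    have h1 : π (zedL q) = chainNext A j q := H q hq
    simp only [zedL] at h1 hzout
    rw [hzout] at h1
    unfold chainNext at h1
    split at h1 <;> simp [zedL] at h1
  intro q
  induction q using WellFoundedGT.induction with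
  | ind q ih =>
    intro hq
    -- the chain successor `y` of `zed q` has `zed q` as its only possible predecessor
    cases hn : nextOcc A j q with
    | none =>
      -- `y = s_{j+1}`
      have hy : chainNext A j q = Node.sw j.succ := by unfold chainNext; rw [hn]
      rw [hy]
      rcases of_adj_sw A (hc.adj_symm (.sw j.succ)) with
        ⟨a', b', h, hn1⟩ | ⟨a', b', h, hcs⟩ | ⟨j', h, hsn⟩
      · obtain ⟨-, -, h0⟩ := n1T_eq_sw hn1
        simp at h0
      · obtain ⟨j', hj', hnone, hjs⟩ := chainSucc_eq_some_sw A hcs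
        have hjj : j' = j := (Fin.succ_injective _ hjs).symm
        subst hjj
        have hp : toLex (a', b') ∈ occL A j' := (mem_occL A).2 hj'
        have := eq_of_nextOcc_none A hq hp hn hnone
        subst this
        exact apply_of_symm_eq h
      · exfalso
        have h1 := swNext_eq_sw hsn
        have hjc : j' = j.castSucc := Fin.ext (by simp at h1 ⊢; omega)
        subst hjc
        exact hsw ((apply_of_symm_eq h).trans (by
          rcases swNext_shape (N := N) j.castSucc with ⟨j'', hj'', h'⟩ | ⟨hjt, h'⟩
          · rw [h']; congr 1; apply Fin.ext; simp at hj'' ⊢; omega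
          · simp at hjt; omega))
    | some q' =>
      have hy : chainNext A j q = zedL q' := by unfold chainNext; rw [hn]
      rw [hy]
      obtain ⟨hq'm, hlt, hmin⟩ := nextOcc_spec A hn
      obtain ⟨hq'next, hq'nzin⟩ : π (zedL q') = chainNext A j q' ∧
          ¬ (π.symm (zedL q') = Node.bead (ofLex q').1 (ofLex q').2 0 ∨
            π.symm (zedL q') = Node.bead (ofLex q').1 (ofLex q').2 1) := by
        refine ⟨ih q' hlt hq'm, fun hzin => ?_⟩
        have hzout := hc.zout_of_zin hrow hzin
        have h1 := ih q' hlt hq'm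
        simp only [zedL] at hzout h1
        rw [hzout] at h1
        unfold chainNext at h1
        split at h1 <;> simp [zedL] at h1
      rcases of_adj_zed A (hc.adj_symm (zedL q')) with h | h | ⟨a', b', h, hcs⟩ | ⟨j', h, hst⟩
      · exact absurd (Or.inl h) hq'nzin
      · exact absurd (Or.inr h) hq'nzin
      · obtain ⟨j', hj', hn'⟩ := chainSucc_eq_some_zed A hcs
        have hn'' : nextOcc A j' (toLex (a', b')) = some q' := hn'
        obtain ⟨hq'm', -, -⟩ := nextOcc_spec A hn''
        have hjj : j' = j := occL_unique A hq'm' hq'm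
        subst hjj
        have hp : toLex (a', b') ∈ occL A j' := (mem_occL A).2 hj'
        have := eq_of_nextOcc_eq A hq hp hn hn''
        subst this
        exact apply_of_symm_eq h
      · exfalso
        obtain ⟨hj, hf⟩ := chainStart_eq_some_zed A hst
        obtain ⟨hfm, hfmin⟩ := firstOcc_spec A hf
        have hjj : (⟨j', hj⟩ : Fin t) = j := occL_unique A hfm hq'm
        subst hjj
        exact absurd (hfmin q hq) (not_le.2 hlt)

/-- **No fed beads**: a detour node exited into its bead was entered from its bead
(`zout → zin`). [cite: vonzurGathen1987, Thm. 5.6] -/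
theorem zin_of_zout (hrow : RowProp A) {a b : Fin N} (h : π (Node.zed a b) = Node.bead a b 3) :
    π.symm (Node.zed a b) = Node.bead a b 0 ∨ π.symm (Node.zed a b) = Node.bead a b 1 := by
  by_contra hzin
  rw [not_or] at hzin
  obtain ⟨j, hj⟩ := hc.isY_of_fed hzin.1 hzin.2
  have hq : toLex (a, b) ∈ occL A j := (mem_occL A).2 hj
  by_cases hsw : π (Node.sw j.castSucc) = swNext j.castSucc
  · exact absurd (hc.zin_of_sw_direct hrow j hsw _ hq) (not_or.2 hzin)
  · have h1 := (hc.chain_of_sw_chain hrow j hsw _ hq).1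
    simp only [zedL, ofLex_toLex] at h1
    rw [h] at h1
    unfold chainNext at h1
    split at h1 <;> simp [zedL] at h1

/-! ### Global structure III: lanes and the use row of a block -/

/-- **The five patterns.** Under the row property every bead is in one of the intended
patterns `L0c, L0z, Uz, L1c, L1z` (the escape and the fed hybrids are excluded). [cite: vonzurGathen1987, Thm. 5.6] -/
theorem pattern5 (hrow : RowProp A) (a b : Fin N) :
    PatSpec π a b .L0c ∨ PatSpec π a b .L0z ∨ PatSpec π a b .Uz ∨
      PatSpec π a b .L1c ∨ PatSpec π a b .L1z := by
  obtain ⟨κ, hκ⟩ := hc.pattern a b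
  cases κ with
  | L0c => exact Or.inl hκ
  | L0z => exact Or.inr (Or.inl hκ)
  | H7 =>
    obtain ⟨-, -, -, hz, -, h0, h1⟩ := hκ
    exact absurd (hc.zin_of_zout hrow hz) (not_or.2 ⟨h0, h1⟩)
  | Uz => exact Or.inr (Or.inr (Or.inl hκ))
  | H1 =>
    obtain ⟨-, -, -, -, hz, h0, h1⟩ := hκ
    exact absurd (hc.zin_of_zout hrow hz) (not_or.2 ⟨h0, h1⟩)
  | E16 => exact absurd hκ (hc.no_escape hrow a b)
  | L1c => exact Or.inr (Or.inr (Or.inr (Or.inl hκ)))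
  | L1z => exact Or.inr (Or.inr (Or.inr (Or.inr hκ)))
  | H2 =>
    obtain ⟨-, -, hz, -, -, h0, h1⟩ := hκ
    exact absurd (hc.zin_of_zout hrow hz) (not_or.2 ⟨h0, h1⟩)

/-- The beads of the first row are entered on lane `0` (their port `1` has no arc from
outside). [cite: vonzurGathen1987, Thm. 5.6] -/
theorem lane0_first (b : Fin N) : π (Node.bead 0 b 2) = Node.bead 0 b 1 := by
  rcases (adj_bead2 A 0 b _).1 (hc.adj (.bead 0 b 2)) with h | h
  · exact h
  · exfalso
    rcases of_adj_bead1 A (hc.adj_symm (.bead 0 b 1)) with h' | ⟨a', b', _, hn1⟩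
    · have := apply_of_symm_eq h'; rw [h] at this; simp at this
    · obtain ⟨h1, -⟩ := n1T_eq_bead1 hn1
      simp at h1

/-- Below a lane-0 bypass the next bead is entered on lane `0`. [cite: vonzurGathen1987, Thm. 5.6] -/
theorem lane0_step {a b a' : Fin N} (ha' : (a' : ℕ) = a + 1)
    (h : PatSpec π a b .L0c ∨ PatSpec π a b .L0z) :
    π (Node.bead a' b 2) = Node.bead a' b 1 := by
  have h3 : n0T a b = some (π (Node.bead a b 3)) := by
    rcases h with h | h
    · exact h.2.2.2.1
    · exact h.2.2.2.2
  obtain ⟨a'', ha'', h''⟩ := n0T_eq_some h3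
  have : a'' = a' := Fin.ext (by omega)
  subst this
  rcases (adj_bead2 A a'' b _).1 (hc.adj (.bead a'' b 2)) with h' | h'
  · exact h'
  · exact absurd (π.injective (h'.trans h''.symm)) (by simp)

/-- Below a use the next bead is entered on lane `1` (through the hub). [cite: vonzurGathen1987, Thm. 5.6] -/
theorem lane1_step_of_use (hrow : RowProp A) {a b a' : Fin N} (ha' : (a' : ℕ) = a + 1)
    (h : PatSpec π a b .Uz) : π (Node.bead a' b 2) = Node.bead a' b 0 := by
  have hh := hc.hub_return hrow h.2.2.2.2
  rcases n1T_shape (t := t) a b with ⟨a'', ha'', hn⟩ | ⟨haN, _⟩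
  · have : a'' = a' := Fin.ext (by omega)
    subst this
    rw [hn] at hh
    rcases (adj_bead2 A a'' b _).1 (hc.adj (.bead a'' b 2)) with h' | h'
    · exact absurd (π.injective (h'.trans hh.symm)) (by simp)
    · exact h'
  · omega

/-- Below a lane-1 bypass the next bead is entered on lane `1`. [cite: vonzurGathen1987, Thm. 5.6] -/
theorem lane1_step {a b a' : Fin N} (ha' : (a' : ℕ) = a + 1)
    (h : PatSpec π a b .L1c ∨ PatSpec π a b .L1z) :
    π (Node.bead a' b 2) = Node.bead a' b 0 := by
  have h0 : π (Node.bead a b 0) = n1T a b := by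
    rcases h with h | h
    · exact h.2.2.2.1
    · exact h.2.2.2.2
  rcases n1T_shape (t := t) a b with ⟨a'', ha'', hn⟩ | ⟨haN, _⟩
  · have : a'' = a' := Fin.ext (by omega)
    subst this
    rw [hn] at h0
    rcases (adj_bead2 A a'' b _).1 (hc.adj (.bead a'' b 2)) with h' | h'
    · exact absurd (π.injective (h'.trans h0.symm)) (by simp)
    · exact h'
  · omega

/-- A bead entered on lane `0` is a lane-0 bypass or a use; on lane `1`, a lane-1 bypass. [cite: vonzurGathen1987, Thm. 5.6] -/
theorem of_lane0 (hrow : RowProp A) {a b : Fin N} (h : π (Node.bead a b 2) = Node.bead a b 1) :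
    (PatSpec π a b .L0c ∨ PatSpec π a b .L0z) ∨ PatSpec π a b .Uz := by
  rcases hc.pattern5 hrow a b with h' | h' | h' | h' | h'
  · exact Or.inl (Or.inl h')
  · exact Or.inl (Or.inr h')
  · exact Or.inr h'
  · rw [h'.1] at h; simp at h
  · rw [h'.1] at h; simp at h

/-- A bead entered on lane `1` is a lane-1 bypass. [cite: vonzurGathen1987, Thm. 5.6] -/
theorem of_lane1 (hrow : RowProp A) {a b : Fin N} (h : π (Node.bead a b 2) = Node.bead a b 0) :
    PatSpec π a b .L1c ∨ PatSpec π a b .L1z := by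
  rcases hc.pattern5 hrow a b with h' | h' | h' | h' | h'
  · rw [h'.2.1] at h; simp at h
  · rw [h'.2.1] at h; simp at h
  · rw [h'.2.2.2.1] at h; simp at h
  · exact Or.inl h'
  · exact Or.inr h'

/-- After a use or a lane-1 bead, every later bead of the block is entered on lane `1`. [cite: vonzurGathen1987, Thm. 5.6] -/
theorem lane1_below (hrow : RowProp A) {s b : Fin N}
    (hs : PatSpec π s b .Uz ∨ PatSpec π s b .L1c ∨ PatSpec π s b .L1z) :
    ∀ a : Fin N, s < a → π (Node.bead a b 2) = Node.bead a b 0 := by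
  -- induction on the distance below `s`
  suffices H : ∀ d : ℕ, ∀ a : Fin N, (a : ℕ) = s + d + 1 → π (Node.bead a b 2) = Node.bead a b 0 by
    intro a hlt
    exact H (a - s - 1) a (by have := Fin.lt_def.1 hlt; omega)
  intro d
  induction d with
  | zero =>
    intro a ha
    rcases hs with h | h | h
    · exact hc.lane1_step_of_use hrow (by omega) h
    · exact hc.lane1_step (by omega) (Or.inl h)
    · exact hc.lane1_step (by omega) (Or.inr h)
  | succ d ih =>
    intro a ha
    have ha' : s + d + 1 < N := by omega
    have h1 := ih ⟨s + d + 1, ha'⟩ rfl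
    exact hc.lane1_step (by simp; omega) (hc.of_lane1 hrow h1)

/-- **The use row of a block.** Every block `b` has exactly one use bead; above it the beads
are lane-0 bypasses, below it lane-1 bypasses. [cite: vonzurGathen1987, Thm. 5.6] -/
theorem exists_use (hrow : RowProp A) (b : Fin N) : ∃ s : Fin N, PatSpec π s b .Uz := by
  by_contra hno
  rw [not_exists] at hno
  -- then every bead of the block is a lane-0 bypass, including the last one
  have hall : ∀ d : ℕ, ∀ a : Fin N, (a : ℕ) = d → PatSpec π a b .L0c ∨ PatSpec π a b .L0z := by
    intro d
    induction d with
    | zero =>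
      intro a ha
      have ha0 : a = 0 := Fin.ext (by simp [ha])
      subst ha0
      rcases hc.of_lane0 hrow (hc.lane0_first b) with h | h
      · exact h
      · exact absurd h (hno 0)
    | succ d ih =>
      intro a ha
      have hd : d < N := by omega
      have h0 := ih ⟨d, hd⟩ rfl
      rcases hc.of_lane0 hrow (hc.lane0_step (a := ⟨d, hd⟩) (a' := a) ha h0) with h | h
      · exact h
      · exact absurd h (hno a)
  have hN : 0 < N := Nat.pos_of_ne_zero (NeZero.ne N)
  have hlast := hall (N - 1) ⟨N - 1, by omega⟩ rfl
  have h3 : n0T (⟨N - 1, by omega⟩ : Fin N) b = some (π (Node.bead ⟨N - 1, by omega⟩ b 3)) := by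
    rcases hlast with h | h
    · exact h.2.2.2.1
    · exact h.2.2.2.2
  obtain ⟨a', ha', -⟩ := n0T_eq_some h3
  simp at ha'
  omega

/-- Above a use, only lane-0 bypasses; the use row is unique. [cite: vonzurGathen1987, Thm. 5.6] -/
theorem use_unique (hrow : RowProp A) {s s' b : Fin N} (hs : PatSpec π s b .Uz)
    (hs' : PatSpec π s' b .Uz) : s = s' := by
  rcases lt_trichotomy s s' with hl | he | hg
  · have := hc.lane1_below hrow (Or.inl hs) s' hl
    rw [hs'.2.2.2.1] at this; simp at this
  · exact he
  · have := hc.lane1_below hrow (Or.inl hs') s hg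
    rw [hs.2.2.2.1] at this; simp at this

/-- Above the use row the beads are lane-0 bypasses. [cite: vonzurGathen1987, Thm. 5.6] -/
theorem lane0_above (hrow : RowProp A) {s b : Fin N} (hs : PatSpec π s b .Uz) :
    ∀ a : Fin N, a < s → PatSpec π a b .L0c ∨ PatSpec π a b .L0z := by
  -- by induction from the top of the block: as long as no use is met, lane 0 persists
  suffices H : ∀ d : ℕ, ∀ a : Fin N, (a : ℕ) = d → a < s → PatSpec π a b .L0c ∨ PatSpec π a b .L0z by
    intro a ha; exact H a a rfl ha
  intro d
  induction d with
  | zero =>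
    intro a ha hlt
    have ha0 : a = 0 := Fin.ext (by simp [ha])
    subst ha0
    rcases hc.of_lane0 hrow (hc.lane0_first b) with h | h
    · exact h
    · exact absurd (hc.use_unique hrow h hs) (ne_of_lt hlt)
  | succ d ih =>
    intro a ha hlt
    have hd : d < N := by omega
    have h0 := ih ⟨d, hd⟩ rfl (lt_trans (Fin.lt_def.2 (by simp [ha])) hlt)
    rcases hc.of_lane0 hrow (hc.lane0_step (a := ⟨d, hd⟩) (a' := a) ha h0) with h | h
    · exact h
    · exact absurd (hc.use_unique hrow h hs) (ne_of_lt hlt)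

/-- Below the use row the beads are lane-1 bypasses. [cite: vonzurGathen1987, Thm. 5.6] -/
theorem lane1_below_use (hrow : RowProp A) {s b : Fin N} (hs : PatSpec π s b .Uz) :
    ∀ a : Fin N, s < a → PatSpec π a b .L1c ∨ PatSpec π a b .L1z :=
  fun a ha => hc.of_lane1 hrow (hc.lane1_below hrow (Or.inl hs) a ha)

/-- The use row of the block `b`. [cite: vonzurGathen1987, Thm. 5.6] -/
def useRow (hrow : RowProp A) (b : Fin N) : Fin N :=
  Classical.choose (hc.exists_use hrow b)

/-- The use row is used. [cite: vonzurGathen1987, Thm. 5.6] -/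
theorem useRow_spec (hrow : RowProp A) (b : Fin N) : PatSpec π (hc.useRow hrow b) b .Uz :=
  Classical.choose_spec (hc.exists_use hrow b)

/-- Distinct blocks use distinct rows (a hub is entered once). [cite: vonzurGathen1987, Thm. 5.6] -/
theorem useRow_injective (hrow : RowProp A) : Function.Injective (hc.useRow hrow) := by
  intro b b' h
  have h1 := (hc.useRow_spec hrow b).2.2.2.2
  have h2 := (hc.useRow_spec hrow b').2.2.2.2
  rw [h] at h1
  have := π.injective (h1.trans h2.symm)
  simpa using this

/-- **The permutation of a cover**: block `b` uses row `σ b`. [cite: vonzurGathen1987, Thm. 5.6] -/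
def usePerm (hrow : RowProp A) : Equiv.Perm (Fin N) :=
  Equiv.ofBijective (hc.useRow hrow) (Finite.injective_iff_bijective.1 (hc.useRow_injective hrow))

/-- `usePerm b` is the use row of block `b`. [cite: vonzurGathen1987, Thm. 5.6] -/
theorem usePerm_apply (hrow : RowProp A) (b : Fin N) : hc.usePerm hrow b = hc.useRow hrow b := rfl

end IsCover

/-! ### The structured successor function -/

section Structured

variable (A)
variable (ρ : Equiv.Perm (Fin N)) (w : Fin t → Bool)

/-- Whether the detour node at `(a, b)` is absorbed by its bead in the configuration `w`:
always, unless `(a, b)` holds a Boolean variable whose chain is switched on (`w j = false`). [cite: vonzurGathen1987, Lemma 5.1] -/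
def zabs (a b : Fin N) : Bool :=
  match A a b with
  | Sum.inr (Sum.inr j) => w j
  | _ => true

/-- **The structured cover** attached to a permutation `ρ` of the rows (block `b` uses row
`ρ b`) and a switch configuration `w` (`w j = true`: the chain of `Y_j` is off), as a successor
function: lane-0 bypasses above the use row, the use pattern at it, lane-1 bypasses below, the
detour through `z` iff `zabs`, hubs returning to their block, chains on or off. [cite: vonzurGathen1987, Thm. 5.6] -/
def bsucc : Node N t → Node N t
  | .bead a b i =>
      if i = 0 then (if a < ρ b then .bead a b 2 else if a = ρ b then .zed a b else n1T a b)
      else if i = 1 then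
        (if a = ρ b then .hub a else if zabs A w a b then .zed a b else .bead a b 3)
      else if i = 2 then (if ρ b < a then .bead a b 0 else .bead a b 1)
      else (if a < ρ b then (n0T a b).getD (.bead a b 2) else .bead a b 2)
  | .zed a b => if zabs A w a b then .bead a b 3 else (chainSucc A a b).getD (.bead a b 3)
  | .hub a => n1T a (ρ.symm a)
  | .sw j => if h : (j : ℕ) < t then
        (if w ⟨j, h⟩ then swNext j else (chainStart A j).getD (swNext j))
      else swNext j

variable {A ρ w}

/-- `bsucc` on port `0` above the use row. [cite: vonzurGathen1987, Thm. 5.6] -/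
theorem bsucc_bead0_lt {a b : Fin N} (h : a < ρ b) : bsucc A ρ w (.bead a b 0) = .bead a b 2 := by
  simp [bsucc, h]
/-- `bsucc` on port `0` at the use row. [cite: vonzurGathen1987, Thm. 5.6] -/
theorem bsucc_bead0_eq {a b : Fin N} (h : a = ρ b) : bsucc A ρ w (.bead a b 0) = .zed a b := by
  simp [bsucc, h]
/-- `bsucc` on port `0` below the use row. [cite: vonzurGathen1987, Thm. 5.6] -/
theorem bsucc_bead0_gt {a b : Fin N} (h : ρ b < a) : bsucc A ρ w (.bead a b 0) = n1T a b := by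
  simp [bsucc, not_lt.2 (le_of_lt h), ne_of_gt h]
/-- `bsucc` on port `1` at the use row. [cite: vonzurGathen1987, Thm. 5.6] -/
theorem bsucc_bead1_eq {a b : Fin N} (h : a = ρ b) : bsucc A ρ w (.bead a b 1) = .hub a := by
  simp [bsucc, h]
/-- `bsucc` on port `1` off the use row, detour absorbed. [cite: vonzurGathen1987, Thm. 5.6] -/
theorem bsucc_bead1_abs {a b : Fin N} (h : a ≠ ρ b) (hz : zabs A w a b = true) :
    bsucc A ρ w (.bead a b 1) = .zed a b := by
  simp [bsucc, h, hz]
/-- `bsucc` on port `1` off the use row, chain on. [cite: vonzurGathen1987, Thm. 5.6] -/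
theorem bsucc_bead1_nabs {a b : Fin N} (h : a ≠ ρ b) (hz : zabs A w a b = false) :
    bsucc A ρ w (.bead a b 1) = .bead a b 3 := by
  simp [bsucc, h, hz]
/-- `bsucc` on `p2` below the use row. [cite: vonzurGathen1987, Thm. 5.6] -/
theorem bsucc_bead2_gt {a b : Fin N} (h : ρ b < a) : bsucc A ρ w (.bead a b 2) = .bead a b 0 := by
  simp [bsucc, h]
/-- `bsucc` on `p2` at or above the use row. [cite: vonzurGathen1987, Thm. 5.6] -/
theorem bsucc_bead2_le {a b : Fin N} (h : ¬ ρ b < a) : bsucc A ρ w (.bead a b 2) = .bead a b 1 := by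
  simp [bsucc, h]
/-- `bsucc` on `p3` above the use row. [cite: vonzurGathen1987, Thm. 5.6] -/
theorem bsucc_bead3_lt {a b : Fin N} (h : a < ρ b) :
    bsucc A ρ w (.bead a b 3) = (n0T a b).getD (.bead a b 2) := by
  simp [bsucc, h]
/-- `bsucc` on `p3` at or below the use row. [cite: vonzurGathen1987, Thm. 5.6] -/
theorem bsucc_bead3_ge {a b : Fin N} (h : ¬ a < ρ b) : bsucc A ρ w (.bead a b 3) = .bead a b 2 := by
  simp [bsucc, h]
/-- `bsucc` on an absorbed detour node. [cite: vonzurGathen1987, Thm. 5.6] -/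
theorem bsucc_zed_abs {a b : Fin N} (hz : zabs A w a b = true) : bsucc A ρ w (.zed a b) = .bead a b 3 := by
  simp [bsucc, hz]
/-- `bsucc` on a detour node of a chain that is on. [cite: vonzurGathen1987, Lemma 5.1] -/
theorem bsucc_zed_nabs {a b : Fin N} (hz : zabs A w a b = false) :
    bsucc A ρ w (.zed a b) = (chainSucc A a b).getD (.bead a b 3) := by
  simp [bsucc, hz]
/-- `bsucc` on a hub. [cite: vonzurGathen1987, Thm. 5.6] -/
theorem bsucc_hub (a : Fin N) : bsucc A ρ w (.hub a) = n1T a (ρ.symm a) := rfl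
/-- `bsucc` on the switch of a chain that is off. [cite: vonzurGathen1987, Lemma 5.1] -/
theorem bsucc_sw_true (j : Fin t) (hw : w j = true) : bsucc A ρ w (.sw j.castSucc) = swNext j.castSucc := by
  simp [bsucc, hw]
/-- `bsucc` on the switch of a chain that is on. [cite: vonzurGathen1987, Lemma 5.1] -/
theorem bsucc_sw_false (j : Fin t) (hw : w j = false) :
    bsucc A ρ w (.sw j.castSucc) = (chainStart A j.castSucc).getD (swNext j.castSucc) := by
  simp [bsucc, hw]
/-- `bsucc` on the closing switch node `s_t`. [cite: vonzurGathen1987, Thm. 5.6] -/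
theorem bsucc_sw_last : bsucc A ρ w (.sw (Fin.last t)) = swNext (Fin.last t) := by
  simp [bsucc]

omit [NeZero N] in
/-- `zabs` is `true` off the Boolean variables. [cite: vonzurGathen1987, Lemma 5.1] -/
theorem zabs_of_not_isY {a b : Fin N} (h : ∀ j : Fin t, A a b ≠ Sum.inr (Sum.inr j)) :
    zabs A w a b = true := by
  unfold zabs
  split
  · rename_i j hj; exact absurd hj (h j)
  · rfl

omit [NeZero N] in
/-- `zabs` at an occurrence of `Y_j` is `w j`. [cite: vonzurGathen1987, Lemma 5.1] -/
theorem zabs_of_isY {a b : Fin N} {j : Fin t} (h : A a b = Sum.inr (Sum.inr j)) :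
    zabs A w a b = w j := by
  unfold zabs
  rw [h]

end Structured

/-! ### Global structure IV: a cover is the structured cover of its configuration -/

/-- The switch configuration of a cover: `true` iff the switch `s_j` takes its direct arc. [cite: vonzurGathen1987, Lemma 5.1] -/
def switchW (π : Equiv.Perm (Node N t)) : Fin t → Bool :=
  fun j => decide (π (Node.sw j.castSucc) = swNext j.castSucc)

namespace IsCover

variable (hc : IsCover A π)
include hc

/-- The detour node is entered from its bead iff `zabs` holds in the cover's configuration:
the `true` direction. [cite: vonzurGathen1987, Lemma 5.1] -/
theorem zin_of_zabs (hrow : RowProp A) {a b : Fin N} (h : zabs A (switchW π) a b = true) :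
    π.symm (Node.zed a b) = Node.bead a b 0 ∨ π.symm (Node.zed a b) = Node.bead a b 1 := by
  by_cases hY : ∃ j : Fin t, A a b = Sum.inr (Sum.inr j)
  · obtain ⟨j, hj⟩ := hY
    rw [zabs_of_isY hj] at h
    have hsw : π (Node.sw j.castSucc) = swNext j.castSucc := of_decide_eq_true h
    exact hc.zin_of_sw_direct hrow j hsw (toLex (a, b)) ((mem_occL A).2 hj)
  · by_contra hzin
    rw [not_or] at hzin
    exact hY (hc.isY_of_fed hzin.1 hzin.2)

/-- The `false` direction: a detour node of a chain that is on is not entered from its bead,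
and passes on along the chain. [cite: vonzurGathen1987, Lemma 5.1] -/
theorem chain_of_not_zabs (hrow : RowProp A) {a b : Fin N} (h : zabs A (switchW π) a b = false) :
    ¬ (π.symm (Node.zed a b) = Node.bead a b 0 ∨ π.symm (Node.zed a b) = Node.bead a b 1) ∧
      π (Node.zed a b) = (chainSucc A a b).getD (Node.bead a b 3) := by
  by_cases hY : ∃ j : Fin t, A a b = Sum.inr (Sum.inr j)
  · obtain ⟨j, hj⟩ := hY
    rw [zabs_of_isY hj] at h
    have hsw : π (Node.sw j.castSucc) ≠ swNext j.castSucc := fun h' => by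
      have : switchW π j = true := decide_eq_true h'
      rw [this] at h; exact Bool.noConfusion h
    have hq : toLex (a, b) ∈ occL A j := (mem_occL A).2 hj
    obtain ⟨h1, h2⟩ := hc.chain_of_sw_chain hrow j hsw _ hq
    simp only [zedL, ofLex_toLex] at h1 h2
    refine ⟨h2, ?_⟩
    have hcs := chainSucc_eq_chainNext hq
    simp only [ofLex_toLex] at hcs
    rw [hcs, Option.getD_some]
    exact h1
  · rw [zabs_of_not_isY (fun j hj => hY ⟨j, hj⟩)] at h
    exact Bool.noConfusion h

/-- **A cover is the structured cover of its configuration**: `π = bsucc A ρ w` pointwise,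
with `ρ` the use permutation and `w` the switch configuration of `π`. [cite: vonzurGathen1987, Thm. 5.6] -/
theorem eq_bsucc (hrow : RowProp A) (x : Node N t) :
    π x = bsucc A (hc.usePerm hrow) (switchW π) x := by
  cases x with
  | bead a b i =>
    have hρ : hc.usePerm hrow b = hc.useRow hrow b := rfl
    have hs := hc.useRow_spec hrow b
    rcases lt_trichotomy a (hc.useRow hrow b) with hlt | heq | hgt
    · -- above the use row: a lane-0 bypass
      have hl := hc.lane0_above hrow hs a hlt
      have hne : a ≠ hc.usePerm hrow b := by rw [hρ]; exact ne_of_lt hlt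
      by_cases hz : zabs A (switchW π) a b = true
      · have hzin := hc.zin_of_zabs hrow hz
        have hP : PatSpec π a b .L0z := by
          rcases hl with h | h
          · rcases hzin with h' | h'
            · exact absurd h' h.2.2.2.2.1
            · exact absurd h' h.2.2.2.2.2.1
          · exact h
        obtain ⟨c0, c2, c1, cz, c3⟩ := hP
        fin_cases i <;> simp only [Fin.zero_eta, Fin.mk_one, Fin.reduceFinMk]
        · rw [c0, bsucc_bead0_lt (hρ ▸ hlt)]
        · rw [c1, bsucc_bead1_abs hne hz]
        · rw [c2, bsucc_bead2_le (by rw [hρ]; exact not_lt.2 (le_of_lt hlt))]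
        · rw [bsucc_bead3_lt (hρ ▸ hlt), c3]; rfl
      · have hz' : zabs A (switchW π) a b = false := by simpa using hz
        have hzin := (hc.chain_of_not_zabs hrow hz').1
        have hP : PatSpec π a b .L0c := by
          rcases hl with h | h
          · exact h
          · exact absurd (Or.inr (by rw [← h.2.2.1]; simp)) hzin
        obtain ⟨c0, c2, c1, c3, -, -, -⟩ := hP
        fin_cases i <;> simp only [Fin.zero_eta, Fin.mk_one, Fin.reduceFinMk]
        · rw [c0, bsucc_bead0_lt (hρ ▸ hlt)]
        · rw [c1, bsucc_bead1_nabs hne hz']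
        · rw [c2, bsucc_bead2_le (by rw [hρ]; exact not_lt.2 (le_of_lt hlt))]
        · rw [bsucc_bead3_lt (hρ ▸ hlt), c3]; rfl
    · -- the use row
      have heq' : a = hc.usePerm hrow b := by rw [hρ]; exact heq
      rw [← heq] at hs
      obtain ⟨c0, cz, c3, c2, c1⟩ := hs
      fin_cases i <;> simp only [Fin.zero_eta, Fin.mk_one, Fin.reduceFinMk]
      · rw [c0, bsucc_bead0_eq heq']
      · rw [c1, bsucc_bead1_eq heq']
      · rw [c2, bsucc_bead2_le (by rw [← heq']; exact lt_irrefl _)]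
      · rw [c3, bsucc_bead3_ge (by rw [← heq']; exact lt_irrefl _)]
    · -- below the use row: a lane-1 bypass
      have hl := hc.lane1_below_use hrow hs a hgt
      have hne : a ≠ hc.usePerm hrow b := by rw [hρ]; exact ne_of_gt hgt
      have hgt' : hc.usePerm hrow b < a := by rw [hρ]; exact hgt
      by_cases hz : zabs A (switchW π) a b = true
      · have hzin := hc.zin_of_zabs hrow hz
        have hP : PatSpec π a b .L1z := by
          rcases hl with h | h
          · rcases hzin with h' | h'
            · exact absurd h' h.2.2.2.2.1
            · exact absurd h' h.2.2.2.2.2.1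
          · exact h
        obtain ⟨c2, c1, cz, c3, c0⟩ := hP
        fin_cases i <;> simp only [Fin.zero_eta, Fin.mk_one, Fin.reduceFinMk]
        · rw [c0, bsucc_bead0_gt hgt']
        · rw [c1, bsucc_bead1_abs hne hz]
        · rw [c2, bsucc_bead2_gt hgt']
        · rw [c3, bsucc_bead3_ge (not_lt.2 (le_of_lt hgt'))]
      · have hz' : zabs A (switchW π) a b = false := by simpa using hz
        have hzin := (hc.chain_of_not_zabs hrow hz').1
        have hP : PatSpec π a b .L1c := by
          rcases hl with h | h
          · exact h
          · exact absurd (Or.inr (by rw [← h.2.1]; simp)) hzin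
        obtain ⟨c2, c1, c3, c0, -, -, -⟩ := hP
        fin_cases i <;> simp only [Fin.zero_eta, Fin.mk_one, Fin.reduceFinMk]
        · rw [c0, bsucc_bead0_gt hgt']
        · rw [c1, bsucc_bead1_nabs hne hz']
        · rw [c2, bsucc_bead2_gt hgt']
        · rw [c3, bsucc_bead3_ge (not_lt.2 (le_of_lt hgt'))]
  | zed a b =>
    by_cases hz : zabs A (switchW π) a b = true
    · rw [bsucc_zed_abs hz]
      exact hc.zout_of_zin hrow (hc.zin_of_zabs hrow hz)
    · have hz' : zabs A (switchW π) a b = false := by simpa using hz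
      rw [bsucc_zed_nabs hz']
      exact (hc.chain_of_not_zabs hrow hz').2
  | hub a =>
    rw [bsucc_hub]
    set b := (hc.usePerm hrow).symm a with hb
    have hab : hc.useRow hrow b = a := by
      have : hc.usePerm hrow b = a := by rw [hb]; simp
      exact this
    have hs := hc.useRow_spec hrow b
    rw [hab] at hs
    exact hc.hub_return hrow hs.2.2.2.2
  | sw j =>
    by_cases hj : (j : ℕ) < t
    · have hjc : j = (⟨j, hj⟩ : Fin t).castSucc := Fin.ext rfl
      rw [hjc]
      by_cases hw : switchW π ⟨j, hj⟩ = true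
      · rw [bsucc_sw_true _ hw]
        exact of_decide_eq_true hw
      · have hw' : switchW π ⟨j, hj⟩ = false := by simpa using hw
        rw [bsucc_sw_false _ hw']
        have hne : π (Node.sw (⟨j, hj⟩ : Fin t).castSucc) ≠ swNext (⟨j, hj⟩ : Fin t).castSucc :=
          fun h' => by
            have : switchW π ⟨j, hj⟩ = true := decide_eq_true h'
            rw [this] at hw'; exact Bool.noConfusion hw'
        rcases (adj_sw A _ _).1 (hc.adj (.sw (⟨j, hj⟩ : Fin t).castSucc)) with h | h
        · exact absurd h hne
        · rw [h]; rfl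
    · have hjl : j = Fin.last t := Fin.ext (by have := j.isLt; simp; omega)
      subst hjl
      rw [bsucc_sw_last]
      rcases (adj_sw A _ _).1 (hc.adj (.sw (Fin.last t))) with h | h
      · exact h
      · exfalso
        unfold chainStart at h
        split_ifs at h

/-- The configuration of a cover is **valid**: a chain is on only if its variable occurs and
no occurrence of it is used. [cite: vonzurGathen1987, Lemma 5.1] -/
theorem valid_config (hrow : RowProp A) (j : Fin t) (hw : switchW π j = false) :
    (occL A j).Nonempty ∧ ∀ q ∈ occL A j, hc.usePerm hrow (ofLex q).2 ≠ (ofLex q).1 := by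
  have hsw : π (Node.sw j.castSucc) ≠ swNext j.castSucc := fun h' => by
    have : switchW π j = true := decide_eq_true h'
    rw [this] at hw; exact Bool.noConfusion hw
  constructor
  · rcases (adj_sw A _ _).1 (hc.adj (.sw j.castSucc)) with h | h
    · exact absurd h hsw
    · obtain ⟨hj, q, hq, -⟩ := chainStart_eq_some A h
      have hqm := (firstOcc_spec A hq).1
      have hjj : (⟨(j.castSucc : ℕ), hj⟩ : Fin t) = j := Fin.ext rfl
      rw [hjj] at hqm
      exact ⟨q, hqm⟩
  · intro q hq huse
    have h2 := (hc.chain_of_sw_chain hrow j hsw q hq).2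
    -- a used occurrence would absorb its detour node from `p0`
    have hs := hc.useRow_spec hrow (ofLex q).2
    rw [show hc.useRow hrow (ofLex q).2 = (ofLex q).1 from huse] at hs
    apply h2
    left
    rw [zedL, ← hs.1]
    simp

end IsCover

/-! ### Occurrence bookkeeping II: previous and last occurrences -/

section OccFacts2

variable (A)

omit [NeZero N] in
/-- `nextOcc p = some q` from the defining minimality property. [cite: vonzurGathen1987, Lemma 5.1] -/
theorem nextOcc_eq_some_of {j : Fin t} {p q : Lex (Fin N × Fin N)} (hq : q ∈ occL A j)
    (hlt : p < q) (hmin : ∀ r ∈ occL A j, p < r → q ≤ r) : nextOcc A j p = some q := by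
  unfold nextOcc
  have hne : ((occL A j).filter fun r => p < r).Nonempty := ⟨q, Finset.mem_filter.2 ⟨hq, hlt⟩⟩
  rw [dif_pos hne]
  congr 1
  apply le_antisymm
  · exact Finset.min'_le _ _ (Finset.mem_filter.2 ⟨hq, hlt⟩)
  · apply Finset.le_min'
    intro r hr
    obtain ⟨hr1, hr2⟩ := Finset.mem_filter.1 hr
    exact hmin r hr1 hr2

omit [NeZero N] in
/-- An occurrence that is not the first one has a previous occurrence pointing at it. [cite: vonzurGathen1987, Lemma 5.1] -/
theorem exists_prev_occ {j : Fin t} {q : Lex (Fin N × Fin N)} (hq : q ∈ occL A j)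
    (hnf : firstOcc A j ≠ some q) :
    ∃ p ∈ occL A j, nextOcc A j p = some q := by
  set S := (occL A j).filter fun r => r < q with hS
  have hSne : S.Nonempty := by
    obtain ⟨q₁, hq₁⟩ := firstOcc_isSome A hq
    obtain ⟨hm, hmin⟩ := firstOcc_spec A hq₁
    have hne : q₁ ≠ q := fun h => hnf (by rw [hq₁, h])
    exact ⟨q₁, Finset.mem_filter.2 ⟨hm, lt_of_le_of_ne (hmin q hq) hne⟩⟩
  obtain ⟨hp1, hp2⟩ := Finset.mem_filter.1 (Finset.max'_mem S hSne)
  refine ⟨S.max' hSne, hp1, nextOcc_eq_some_of A hq hp2 fun r hr hlt => ?_⟩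
  by_contra hrq
  have : r ∈ S := Finset.mem_filter.2 ⟨hr, not_le.1 hrq⟩
  exact absurd (Finset.le_max' S r this) (not_le.2 hlt)

omit [NeZero N] in
/-- The last occurrence has no next occurrence. [cite: vonzurGathen1987, Lemma 5.1] -/
theorem nextOcc_max' {j : Fin t} (hne : (occL A j).Nonempty) :
    nextOcc A j ((occL A j).max' hne) = none := by
  unfold nextOcc
  rw [dif_neg]
  rintro ⟨r, hr⟩
  obtain ⟨hr1, hr2⟩ := Finset.mem_filter.1 hr
  exact absurd (Finset.le_max' _ r hr1) (not_le.2 hr2)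

omit [NeZero N] in
/-- `firstOcc` is `some (min')` when there is an occurrence. [cite: vonzurGathen1987, Lemma 5.1] -/
theorem firstOcc_eq_min' {j : Fin t} (hne : (occL A j).Nonempty) :
    firstOcc A j = some ((occL A j).min' hne) := by
  unfold firstOcc
  rw [dif_pos hne]

omit [NeZero N] in
/-- `zabs = false` happens only at an occurrence of a variable whose chain is on. [cite: vonzurGathen1987, Lemma 5.1] -/
theorem isY_of_zabs_false {w : Fin t → Bool} {a b : Fin N} (h : zabs A w a b = false) :
    ∃ j : Fin t, A a b = Sum.inr (Sum.inr j) ∧ w j = false := by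
  unfold zabs at h
  split at h
  · rename_i j hj; exact ⟨j, hj, h⟩
  · exact Bool.noConfusion h

end OccFacts2

/-! ### The structured cover is a supported permutation -/

section StructuredPerm

/-- A configuration `(ρ, w)` is **valid** if every chain that is on (`w j = false`) belongs to
a variable that occurs, none of whose occurrences is used by `ρ`. [cite: vonzurGathen1987, Lemma 5.1] -/
def Valid (A : Matrix (Fin N) (Fin N) (k ⊕ (σ ⊕ Fin t))) (ρ : Equiv.Perm (Fin N))
    (w : Fin t → Bool) : Prop :=
  ∀ j : Fin t, w j = false → (occL A j).Nonempty ∧ ∀ q ∈ occL A j, ρ (ofLex q).2 ≠ (ofLex q).1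

variable {ρ : Equiv.Perm (Fin N)} {w : Fin t → Bool}

/-- The last row. [folklore] -/
def lastRow (N : ℕ) [NeZero N] : Fin N := ⟨N - 1, Nat.sub_one_lt (NeZero.ne N)⟩

omit [NeZero N] in
/-- The structured successor steps along arcs. [cite: vonzurGathen1987, Thm. 5.6] -/
theorem adj_bsucc [NeZero N] (hv : Valid A ρ w) (x : Node N t) : adj A x (bsucc A ρ w x) := by
  cases x with
  | bead a b i =>
    fin_cases i <;> simp only [Fin.zero_eta, Fin.mk_one, Fin.reduceFinMk]
    · rw [adj_bead0]
      rcases lt_trichotomy a (ρ b) with h | h | h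
      · exact Or.inl (bsucc_bead0_lt h)
      · exact Or.inr (Or.inl (bsucc_bead0_eq h))
      · exact Or.inr (Or.inr (bsucc_bead0_gt h))
    · rw [adj_bead1]
      by_cases h : a = ρ b
      · exact Or.inr (Or.inr (bsucc_bead1_eq h))
      · by_cases hz : zabs A w a b = true
        · exact Or.inr (Or.inl (bsucc_bead1_abs h hz))
        · exact Or.inl (bsucc_bead1_nabs h (by simpa using hz))
    · rw [adj_bead2]
      by_cases h : ρ b < a
      · exact Or.inr (bsucc_bead2_gt h)
      · exact Or.inl (bsucc_bead2_le h)
    · rw [adj_bead3]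
      by_cases h : a < ρ b
      · right
        rw [bsucc_bead3_lt h]
        have ha : (a : ℕ) + 1 < N := lt_of_le_of_lt (Nat.succ_le_of_lt (Fin.lt_def.1 h)) (ρ b).isLt
        unfold n0T
        rw [dif_pos ha]
        rfl
      · exact Or.inl (bsucc_bead3_ge h)
  | zed a b =>
    rw [adj_zed]
    by_cases hz : zabs A w a b = true
    · exact Or.inl (bsucc_zed_abs hz)
    · right
      have hz' : zabs A w a b = false := by simpa using hz
      rw [bsucc_zed_nabs hz']
      obtain ⟨j, hj, -⟩ := isY_of_zabs_false A hz'
      have hq : toLex (a, b) ∈ occL A j := (mem_occL A).2 hj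
      have hcs := chainSucc_eq_chainNext hq
      simp only [ofLex_toLex] at hcs
      rw [hcs]
      rfl
  | hub a =>
    rw [adj_hub]
    exact ⟨ρ.symm a, rfl⟩
  | sw j =>
    rw [adj_sw]
    by_cases hj : (j : ℕ) < t
    · have hjc : j = (⟨j, hj⟩ : Fin t).castSucc := Fin.ext rfl
      by_cases hw : w ⟨j, hj⟩ = true
      · left; rw [hjc, bsucc_sw_true _ hw]
      · have hw' : w ⟨j, hj⟩ = false := by simpa using hw
        right
        rw [hjc, bsucc_sw_false _ hw']
        obtain ⟨hne, -⟩ := hv _ hw'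
        rw [← hjc]
        unfold chainStart
        rw [dif_pos hj, firstOcc_eq_min' A hne]
        rfl
    · have hjl : j = Fin.last t := Fin.ext (by have := j.isLt; simp; omega)
      subst hjl
      left; exact bsucc_sw_last

/-- **The structured successor is onto** (hence a permutation): every vertex has an explicit
predecessor. [cite: vonzurGathen1987, Thm. 5.6] -/
theorem bsucc_surjective (hv : Valid A ρ w) : Function.Surjective (bsucc A ρ w) := by
  have hN : 0 < N := Nat.pos_of_ne_zero (NeZero.ne N)
  intro v
  cases v with
  | bead a b i =>
    fin_cases i <;> simp only [Fin.zero_eta, Fin.mk_one, Fin.reduceFinMk]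
    · -- port 0
      by_cases h : ρ b < a
      · exact ⟨.bead a b 2, bsucc_bead2_gt h⟩
      · by_cases ha : 0 < (a : ℕ)
        · -- entered from `p3` of the bead above
          set a' : Fin N := ⟨a - 1, by omega⟩ with ha'
          have hav : (a' : ℕ) = a - 1 := rfl
          have hlt : a' < ρ b := Fin.lt_def.2 (by
            have := Fin.le_def.1 (not_lt.1 h); omega)
          refine ⟨.bead a' b 3, ?_⟩
          rw [bsucc_bead3_lt hlt]
          unfold n0T
          rw [dif_pos (by omega)]
          simp only [Option.getD_some, Node.bead.injEq, and_true]
          exact Fin.ext (by show (a' : ℕ) + 1 = a; omega)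
        · have ha0 : a = 0 := Fin.ext (by rw [Fin.val_zero]; omega)
          subst ha0
          by_cases hb : 0 < (b : ℕ)
          · -- first bead of block `b`: entered from the last bead of block `b - 1`
            set b' : Fin N := ⟨b - 1, by omega⟩ with hb'
            have hbv : (b' : ℕ) = b - 1 := rfl
            have hfirst : (firstT b' : Node N t) = Node.bead (0 : Fin N) b (0 : Fin 4) := by
              unfold firstT
              rw [dif_pos (by omega)]
              simp only [Node.bead.injEq, true_and, and_true]
              exact Fin.ext (by show (b' : ℕ) + 1 = b; omega)
            have hn1 : (n1T (lastRow N) b' : Node N t) = Node.bead (0 : Fin N) b (0 : Fin 4) := by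
              unfold n1T
              rw [dif_neg (by simp [lastRow]; omega), hfirst]
            by_cases hρ : ρ b' = lastRow N
            · refine ⟨.hub (lastRow N), ?_⟩
              rw [bsucc_hub, show ρ.symm (lastRow N) = b' by rw [← hρ]; simp, hn1]
            · refine ⟨.bead (lastRow N) b' 0, ?_⟩
              have hlt : ρ b' < lastRow N := lt_of_le_of_ne
                (Fin.le_def.2 (by have := (ρ b').isLt; simp [lastRow]; omega)) hρ
              rw [bsucc_bead0_gt hlt, hn1]
          · have hb0 : b = 0 := Fin.ext (by rw [Fin.val_zero]; omega)
            subst hb0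
            refine ⟨.sw (Fin.last t), ?_⟩
            rw [bsucc_sw_last]
            unfold swNext
            rw [dif_neg (by simp)]
    · -- port 1
      by_cases h : ρ b < a
      · set a' : Fin N := ⟨a - 1, by omega⟩ with ha'
        have hav : (a' : ℕ) = a - 1 := rfl
        have haa : (a : ℕ) = a' + 1 := by
          have := Fin.lt_def.1 h; omega
        have hn1 : (n1T a' b : Node N t) = Node.bead a b 1 := by
          unfold n1T
          rw [dif_pos (by omega)]
          simp only [Node.bead.injEq, and_true]
          exact Fin.ext haa.symm
        by_cases hρ : ρ b = a'
        · refine ⟨.hub a', ?_⟩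
          rw [bsucc_hub, show ρ.symm a' = b by rw [← hρ]; simp, hn1]
        · have hlt : ρ b < a' := lt_of_le_of_ne (Fin.le_def.2 (by
            have := Fin.lt_def.1 h; omega)) hρ
          exact ⟨.bead a' b 0, by rw [bsucc_bead0_gt hlt, hn1]⟩
      · exact ⟨.bead a b 2, bsucc_bead2_le h⟩
    · -- `p2`
      by_cases h : a < ρ b
      · exact ⟨.bead a b 0, bsucc_bead0_lt h⟩
      · exact ⟨.bead a b 3, bsucc_bead3_ge h⟩
    · -- `p3`
      by_cases hz : zabs A w a b = true
      · exact ⟨.zed a b, bsucc_zed_abs hz⟩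
      · have hz' : zabs A w a b = false := by simpa using hz
        obtain ⟨j, hj, hw⟩ := isY_of_zabs_false A hz'
        have hne : a ≠ ρ b := fun h =>
          (hv j hw).2 (toLex (a, b)) ((mem_occL A).2 hj) (by simpa using h.symm)
        exact ⟨.bead a b 1, bsucc_bead1_nabs hne hz'⟩
  | zed a b =>
    by_cases hz : zabs A w a b = true
    · by_cases ha : a = ρ b
      · exact ⟨.bead a b 0, bsucc_bead0_eq ha⟩
      · exact ⟨.bead a b 1, bsucc_bead1_abs ha hz⟩
    · have hz' : zabs A w a b = false := by simpa using hz
      obtain ⟨j, hj, hw⟩ := isY_of_zabs_false A hz'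
      have hq : toLex (a, b) ∈ occL A j := (mem_occL A).2 hj
      by_cases hfirst : firstOcc A j = some (toLex (a, b))
      · refine ⟨.sw j.castSucc, ?_⟩
        rw [bsucc_sw_false _ hw]
        unfold chainStart
        rw [dif_pos (by simp)]
        simp only [Fin.val_castSucc, Fin.eta, hfirst, Option.map_some, Option.getD_some]
        rfl
      · obtain ⟨p, hp, hnext⟩ := exists_prev_occ A hq hfirst
        refine ⟨zedL p, ?_⟩
        have hzp : zabs A w (ofLex p).1 (ofLex p).2 = false := by
          rw [zabs_of_isY ((mem_occL A).1 hp)]; exact hw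
        rw [zedL, bsucc_zed_nabs hzp, chainSucc_eq_chainNext hp]
        simp only [Option.getD_some]
        unfold chainNext
        rw [hnext]
        rfl
  | hub a =>
    exact ⟨.bead a (ρ.symm a) 1, bsucc_bead1_eq (by simp)⟩
  | sw j =>
    by_cases hj0 : (j : ℕ) = 0
    · -- `s_0`: entered from the last bead of the last block
      have hj : j = 0 := Fin.ext hj0
      subst hj
      have hfirst : firstT (lastRow N) = (Node.sw 0 : Node N t) := by
        unfold firstT; rw [dif_neg (by simp [lastRow]; omega)]
      have hn1 : n1T (lastRow N) (lastRow N) = (Node.sw 0 : Node N t) := by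
        unfold n1T; rw [dif_neg (by simp [lastRow]; omega), hfirst]
      by_cases hρ : ρ (lastRow N) = lastRow N
      · refine ⟨.hub (lastRow N), ?_⟩
        rw [bsucc_hub, show ρ.symm (lastRow N) = lastRow N by
          conv_lhs => rw [← hρ]
          simp, hn1]
      · have hlt : ρ (lastRow N) < lastRow N := lt_of_le_of_ne
          (Fin.le_def.2 (by have := (ρ (lastRow N)).isLt; simp [lastRow]; omega)) hρ
        exact ⟨.bead (lastRow N) (lastRow N) 0, by rw [bsucc_bead0_gt hlt, hn1]⟩
    · set j' : Fin t := ⟨j - 1, by have := j.isLt; omega⟩ with hj'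
      have hjs : j = j'.succ := Fin.ext (by simp [hj']; omega)
      by_cases hw : w j' = true
      · refine ⟨.sw j'.castSucc, ?_⟩
        rw [bsucc_sw_true _ hw, hjs]
        unfold swNext
        rw [dif_pos (by simp)]
        rfl
      · have hw' : w j' = false := by simpa using hw
        obtain ⟨hne, -⟩ := hv _ hw'
        refine ⟨zedL ((occL A j').max' hne), ?_⟩
        have hm := Finset.max'_mem _ hne
        have hzp : zabs A w (ofLex ((occL A j').max' hne)).1 (ofLex ((occL A j').max' hne)).2 =
            false := by
          rw [zabs_of_isY ((mem_occL A).1 hm)]; exact hw'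
        rw [zedL, bsucc_zed_nabs hzp, chainSucc_eq_chainNext hm]
        simp only [Option.getD_some]
        unfold chainNext
        rw [nextOcc_max' A hne, hjs]

/-- **The structured cover as a permutation** of the vertices. [cite: vonzurGathen1987, Thm. 5.6] -/
def bperm (hv : Valid A ρ w) : Equiv.Perm (Node N t) :=
  Equiv.ofBijective (bsucc A ρ w) (Finite.surjective_iff_bijective.1 (bsucc_surjective hv))

/-- `bperm` is `bsucc`. [cite: vonzurGathen1987, Thm. 5.6] -/
@[simp] theorem bperm_apply (hv : Valid A ρ w) (x : Node N t) : bperm hv x = bsucc A ρ w x := rfl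

end StructuredPerm

end GlobalChain

end HCBand

end Literature.Computability.AlgebraicComplexity
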